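import Literature.MathematicalPhysics.StatisticalMechanics.Yuhjtman2015
import Literature.MathematicalPhysics.StatisticalMechanics.Yuhjtman2015Theta
import Literature.MeasureTheory.Lebesgue.OffCentreBall
import Mathlib.Analysis.SpecialFunctions.ImproperIntegrals
import Mathlib.Analysis.SpecialFunctions.Integrals.Basic
import HarnessLib

/-!
# Proof of Yuhjtman's bound `B ≤ 14.316` on the Lennard-Jones stability constant

DISCHARGE of the named fact `Yuhjtman2015_stabilityConstant` (`Yuhjtman2015.lean`):
`theorem Yuhjtman2015_stabilityConstant_holds` — for every `N` and every injective
`x : Fin N → ℝ³`, `∑_{i<j} V_LJ(|xᵢ - xⱼ|) ≥ -(14.316/12) N` with the tree's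
`V_LJ(r) = r⁻¹²/12 - r⁻⁶/6`; equivalently (Yuhjtman 2015, Thm. 9) every finite `Q ⊂ ℝ³` has
`(1/|Q|) ∑_{x ≠ y} Φ(‖x - y‖) > -14.316` for `Φ = 12 V_LJ = r⁻¹² - 2r⁻⁶`.
S. A. Yuhjtman, *A sensible estimate for the stability constant of the Lennard-Jones potential*,
J. Stat. Phys. 160 (2015) 1684–1695 = arXiv:1501.05248. Everything here is proved; the file
introduces no definition and no named fact. It builds on the one-variable facts of
`Yuhjtman2015Theta.lean` (`w₀ = (11/5)^{1/6}`, `A`, `B`, the minus-energy `hLJ = h = -Φ`,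
`gLJ = w h(w)`, the majorant `θ` of Prop. 4 with its truncations `θcut`, `gθ = w θ(w)` and the
midpoint inequality `two_mul_gθ_le`) and on the radial integration formulas of
`Literature/MeasureTheory/Lebesgue/OffCentreBall.lean`.

## The printed proof and this formalisation

* §2, Prop. 3–4. `t(r) = A r⁻¹ - B` touches `h` to second order at `w₀` and `θ = max(t, h)` is
  subharmonic on `ℝ³ ∖ 0` with `h̃ ≤ θ`. DEVIATION (same mathematics, one dimension): for a
  radial function `Θ(x) = θ(‖x‖)` on `ℝ³`, `ΔΘ = (w θ(w))''/w`, so subharmonicity is the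
  convexity of `g_θ(w) = w θ(w)` (`two_mul_gθ_le`), and the mean-value inequality over a ball
  `B(x, c)`, `0 ∉ B`, reads `∫_{r-c}^{r+c} (c² - (w-r)²) g_θ(w) dw ≥ (4c³/3) g_θ(r)`
  (`integral_weight_gθ_ge`, by `g_θ(r+s) + g_θ(r-s) ≥ 2 g_θ(r)`), because by Archimedes' hat-box
  theorem `∫_{B(x,c)} f(‖y‖) dy = (π/r) ∫_{r-c}^{r+c} w (c² - (w-r)²) f(w) dw`
  (`Literature.MeasureTheory.Lebesgue.setLIntegral_ball_radial`, the integrated Formula 1 (b)).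
* Prop. 5 I (`sum_ball_θ_le_lintegral`, `sum_θ_le_of_lintegral_le`): disjoint balls of radius
  `a/2` about `a`-separated points, `∑ θ ≤ |B|⁻¹ ∫ θ^{s} = 24 I(s)/a³` with
  `I(s) = ∫_s^∞ θ w² dw = (100/99) w₀³ - (180/121) w₀ s² + (25/33) s³` (`lintegral_θcut`, written
  out in closed form; `I(0.54) ≤ 1.12282` is the paper's `24 ∫_{0.54}^∞ θ w² < 26.95` and
  `12 ∫/0.98³ < 14.316`).
* Prop. 8 (`ballIntegrand_region2`, `ballIntegrand_region3`, `ballIntegrand_prop8`): for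
  `c = 0.49` and `0.51 ≤ r ≤ 1.03` the average of `θ^{0.54}` over `B(x,c)`, `‖x‖ = r`, is `≥ 1`
  (windows `[0.54, 1]` and `[0.54, 1.39]`, `θ ≥ t`, exact cubic integrals in `r` and `A`, then a
  concave quadratic checked at the end-points); for `r > 1.03` it is `≥ θ(r) ≥ h(r)` (region 1).
* Thm. 9 (`eY_le`, `sum_lintegral_ball_le` = the multiplicity count `k ≤ 1 + C(k,2)`,
  `sum_lintegral_lens_le`, `UY_le_of_separated`): per particle
  `e(p) ≤ |B|⁻¹(∫Θ^{0.54} + ½ ∑_{pairs} ∫_{N_yz} Θ^{0.54}) + ∑_{d<0.98}(h - 1)`; summing,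
  exchanging the sums and using `∑_x Θ^{0.54}_x ≤ K` pointwise (`sum_θcut_le_K`) and the lens
  volume (Formula 1 (a), `Literature.MeasureTheory.Lebesgue.volume_ball_inter_ball_three`), each
  close pair contributes `≤ ½ [K vol(N_d)/|B| + 2(h(d) - 1)] ≤ 0` by the Appendix inequality
  (`appendix_ineq`), leaving `|Q| · 3 I(0.54)/0.49³ ≤ 28.632 |Q|`.
* DEVIATION (constants and the reduction to separated configurations). The paper assumes `Q`
  optimal, invokes the existence of optimal configurations (Prop. 6) and Cor. 7 (`d > 0.684`,
  via the sharper Prop. 5 II) to get `K = 113`. We avoid Prop. 6, Prop. 5 II and Cor. 7 by a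
  strong induction on `Q` (`UY_le`): if some site sum `e_Q(p) ≤ 0`, remove `p`
  (`UY_eq_UY_erase_add`); otherwise the closest pair is at distance `≥ 0.67`
  (`eY_neg_of_close`, from Prop. 5 I: `h(a) + 24 I(0.54)/a³ < 0` for `a ≤ 0.67`, `closePair_neg`),
  and then the argument of Thm. 9 runs with balls of radius `0.335` and `K = 120`
  (`24 I(0.2)/0.67³ < 120`); the Appendix polynomial inequality is re-verified with `120` in place
  of `113` on `[0.67, 0.98]` by a 15-cell monotonicity table (`appendix_cell`, `appendix_ineq`)
  instead of the paper's root isolation for `P'`. The final constant is the paper's: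
  `3 I(0.54)/0.49³ = 12 I(0.54)/0.98³ ≤ 28.6315 < 2 · 14.316`.
* `w₀` is irrational; it is carried with `w₀ ^ 6 = 11/5` and the bracket
  `1.140434 < w₀ < 1.140435` (`w₀_bounds6`); all decimal inequalities are exact rational checks.

Configurations are handled as finite subsets `Q ⊂ ℝ³` with site sums `e_Q(p) = ∑_{z ∈ Q∖p}
h(‖z - p‖)` and `U_Q = ∑_p e_Q(p)`; the statement about injective `x : Fin N → ℝ³` follows by
`Q = image x` and the tree's `two_mul_interactionEnergy`.

## References

* S. A. Yuhjtman, J. Stat. Phys. 160 (2015) 1684–1695, arXiv:1501.05248: §2 (Formulas 1,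
  Observation 2, Prop. 3, Prop. 4), §3 (Prop. 5, Prop. 6, Cor. 7), §4 (Prop. 8), §5 (Thm. 9),
  Appendix. [Yuhjtman2015]
-/

noncomputable section

open Set MeasureTheory Metric
open scoped ENNReal

namespace Literature.MathematicalPhysics.StatisticalMechanics

namespace Yuhjtman2015

namespace Stability

/-! ### Complements on `w₀`, `A`, `h`, `θ` (objects of `Yuhjtman2015Theta.lean`) -/

/-- `(w₀⁻¹)⁶ = 5/11`. [cite: Yuhjtman2015, Observation 2] -/
theorem inv_w₀_pow_six : (w₀⁻¹) ^ 6 = 5 / 11 := by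
  rw [inv_pow, w₀_pow_six]; norm_num

/-- Six-digit brackets `1.140434 < w₀ < 1.140435` (the final constant `12 I(0.54)/0.98³ < 14.316`
has relative room `3 · 10⁻⁵` only). [cite: Yuhjtman2015, Observation 2] -/
theorem w₀_bounds6 : (1140434 / 1000000 : ℝ) < w₀ ∧ w₀ < 1140435 / 1000000 := by
  have h6 := w₀_pow_six
  constructor
  · by_contra h
    have : w₀ ^ 6 ≤ (1140434 / 1000000 : ℝ) ^ 6 := pow_le_pow_left₀ w₀_pos.le (not_lt.1 h) 6
    rw [h6] at this
    norm_num at this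
  · by_contra h
    have : (1140435 / 1000000 : ℝ) ^ 6 ≤ w₀ ^ 6 := pow_le_pow_left₀ (by norm_num) (not_lt.1 h) 6
    rw [h6] at this
    norm_num at this

/-- `h = -12 V_LJ` in the tree's normalisation `lennardJones r = r⁻¹²/12 - r⁻⁶/6`.
[cite: Yuhjtman2015, §1] -/
theorem hLJ_eq_lennardJones (w : ℝ) : hLJ w = -12 * lennardJones w := by
  unfold hLJ lennardJones; ring

/-- `θ = t = A/v - B` on `(-∞, w₀]`. [cite: Yuhjtman2015, Prop. 4] -/
theorem θ_of_le {v : ℝ} (hvw : v ≤ w₀) : θ v = A / v - B := if_pos hvw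

/-- `θ = h` on `(w₀, ∞)`. [cite: Yuhjtman2015, Prop. 4] -/
theorem θ_of_lt {v : ℝ} (hvw : w₀ < v) : θ v = hLJ v := if_neg (not_le.2 hvw)

/-- `t ≤ θ` in the form `A - B v ≤ g_θ(v) = v θ(v)` (`v > 0`; Prop. 3 (b) beyond `w₀`).
[cite: Yuhjtman2015, Prop. 3 (b)] -/
theorem line_le_gθ {v : ℝ} (hv : 0 < v) : A - B * v ≤ gθ v := by
  rcases le_or_gt v w₀ with h | h
  · rw [gθ_of_le hv h]
  · rw [gθ_of_lt h]; exact line_le_gLJ h.le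

/-- `θcut m` is integrable on compact intervals (`0 < m ≤ w₀`). [folklore] -/
theorem integrableOn_θcut_Icc {m : ℝ} (hm : 0 < m) (hmw : m ≤ w₀) (a b : ℝ) :
    IntegrableOn (θcut m) (Icc a b) := by
  rcases le_or_gt a b with hab | hab
  · exact (intervalIntegrable_iff_integrableOn_Icc_of_le hab).1 (intervalIntegrable_θcut hm hmw a b)
  · rw [Icc_eq_empty (not_le.2 hab)]; exact integrableOn_empty

/-! ### The mean-value inequality for `θ` over balls avoiding the origin (1D form of Prop. 4) -/

/-- **Convexity form of the mean-value inequality.** For `0 < c < r` and a cut-off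
`0 < m ≤ min(w₀, r - c)`, `∫_{r-c}^{r+c} (c² - (w-r)²) w θ^{m}(w) dw ≥ (4c³/3) g_θ(r)`:
symmetrise `w = r ± s` and use the midpoint inequality `g_θ(r+s) + g_θ(r-s) ≥ 2 g_θ(r)`
(`two_mul_gθ_le`). With `g_θ(w) = w θ(w)` and the hat-box formula this is
`θ(‖x‖) ≤ |B|⁻¹ ∫_{B(x,c)} θ(‖y‖) dy` (Yuhjtman 2015, Prop. 4). [cite: Yuhjtman2015, Prop. 4] -/
theorem integral_weight_gθ_ge {r c m : ℝ} (hc : 0 < c) (hcr : c < r) (hm : 0 < m) (hmw : m ≤ w₀)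
    (hmr : m ≤ r - c) :
    4 * c ^ 3 / 3 * gθ r ≤ ∫ w in (r - c)..(r + c), (c ^ 2 - (w - r) ^ 2) * w * θcut m w := by
  set f : ℝ → ℝ := fun w => (c ^ 2 - (w - r) ^ 2) * w * θcut m w with hf
  have hfi : ∀ a b, IntervalIntegrable f volume a b := fun a b =>
    (intervalIntegrable_θcut hm hmw a b).continuousOn_mul
      (by fun_prop : Continuous fun w : ℝ => (c ^ 2 - (w - r) ^ 2) * w).continuousOn
  -- shift to `[-c, c]`
  have hI : ∫ w in (r - c)..(r + c), f w = ∫ s in (-c)..c, f (r + s) := by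
    rw [intervalIntegral.integral_comp_add_left f r, show r + -c = r - c by ring]
  -- reflect
  have hI' : ∫ s in (-c)..c, f (r + s) = ∫ s in (-c)..c, f (r - s) := by
    have h := intervalIntegral.integral_comp_neg (fun s => f (r + s)) (a := -c) (b := c)
    simp only [neg_neg, ← sub_eq_add_neg] at h
    exact h.symm
  have h1 : IntervalIntegrable (fun s => f (r + s)) volume (-c) c := by
    have h := (hfi (r + -c) (r + c)).comp_add_left r
    convert h using 1 <;> ring
  have h2 : IntervalIntegrable (fun s => f (r - s)) volume (-c) c := by
    have h := (hfi (r + c) (r - c)).comp_sub_left r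
    convert h using 1 <;> ring
  have h3 : IntervalIntegrable (fun s => (c ^ 2 - s ^ 2) * (2 * gθ r)) volume (-c) c :=
    (by fun_prop : Continuous fun s => (c ^ 2 - s ^ 2) * (2 * gθ r)).intervalIntegrable _ _
  -- pointwise midpoint convexity
  have hpt : ∀ s ∈ Icc (-c) c, (c ^ 2 - s ^ 2) * (2 * gθ r) ≤ f (r + s) + f (r - s) := by
    intro s hs
    have hK : 0 ≤ c ^ 2 - s ^ 2 := by nlinarith [hs.1, hs.2]
    have hθ1 : θcut m (r + s) = θ (r + s) := θcut_of_le (by linarith [hs.1])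
    have hθ2 : θcut m (r - s) = θ (r - s) := θcut_of_le (by linarith [hs.2])
    have e : f (r + s) + f (r - s) = (c ^ 2 - s ^ 2) * (gθ (r + s) + gθ (r - s)) := by
      simp only [hf, gθ, hθ1, hθ2]; ring
    have hmid : 2 * gθ r ≤ gθ (r + s) + gθ (r - s) := by
      rcases le_total 0 s with h0 | h0
      · exact two_mul_gθ_le h0 (by linarith [hs.2])
      · have h := two_mul_gθ_le (neg_nonneg.2 h0) (by linarith [hs.1] : -s < r)
        rw [← sub_eq_add_neg, sub_neg_eq_add, add_comm (gθ (r - s))] at h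
        exact h
    rw [e]
    exact mul_le_mul_of_nonneg_left hmid hK
  have hmono := intervalIntegral.integral_mono_on (by linarith : -c ≤ c) h3 (h1.add h2) hpt
  rw [intervalIntegral.integral_add h1 h2, ← hI', ← two_mul] at hmono
  have hval : ∫ s in (-c)..c, (c ^ 2 - s ^ 2) * (2 * gθ r) = 2 * (4 * c ^ 3 / 3 * gθ r) := by
    rw [intervalIntegral.integral_mul_const, intervalIntegral.integral_sub, integral_pow,
      intervalIntegral.integral_const]
    · simp only [smul_eq_mul]; ring
    all_goals
      apply Continuous.intervalIntegrable
      fun_prop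
  change 4 * c ^ 3 / 3 * gθ r ≤ ∫ w in (r - c)..(r + c), f w
  rw [hI]
  linarith

/-- **Ball-average form.** For `0 < c < r` and a cut-off `0 < s ≤ min(w₀, r - c)` (the ball
`B(x,c)`, `‖x‖ = r`, avoids the region `‖y‖ < s`), the hat-box integrand satisfies
`∫_{r-c}^{r+c} (π/r) w (c² - (w-r)²) θ^{s}(w) dw ≥ (4π/3) c³ θ(r)`, i.e.
`θ(‖x‖) ≤ |B(x,c)|⁻¹ ∫_{B(x,c)} θ^{s}(‖y‖) dy` (Yuhjtman 2015, Prop. 4). [cite: Yuhjtman2015, Prop. 4] -/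
theorem ballIntegrand_θcut_ge {r c s : ℝ} (hc : 0 < c) (hcr : c < r) (hs0 : 0 < s) (hsw : s ≤ w₀)
    (hs : s ≤ r - c) :
    4 * Real.pi / 3 * c ^ 3 * θ r ≤
      ∫ w in (r - c)..(r + c), Real.pi / r * w * (c ^ 2 - (w - r) ^ 2) * θcut s w := by
  have hr : 0 < r := hc.trans hcr
  have heq : EqOn (fun w => Real.pi / r * w * (c ^ 2 - (w - r) ^ 2) * θcut s w)
      (fun w => Real.pi / r * ((c ^ 2 - (w - r) ^ 2) * w * θcut s w)) (uIcc (r - c) (r + c)) :=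
    fun w _ => by ring
  rw [intervalIntegral.integral_congr heq, intervalIntegral.integral_const_mul]
  have h := integral_weight_gθ_ge hc hcr hs0 hsw hs
  rw [show 4 * Real.pi / 3 * c ^ 3 * θ r = Real.pi / r * (4 * c ^ 3 / 3 * gθ r) by
    unfold gθ; field_simp]
  exact mul_le_mul_of_nonneg_left h (by positivity)

/-! ### Ball averages in `ℝ³` and the packing bound (Prop. 4, Prop. 5 I) -/

/-- From a lower bound `L` for the hat-box integral of `θ^{s}` to a lower bound for the ball
integral `∫_{B(x,c)} θ^{s}(‖y - p‖) dy ≥ L` (`0 < c < ‖x - p‖`, `s ≥ 0`).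
[cite: Yuhjtman2015, Prop. 4] -/
theorem lintegral_ball_ge_of_hatbox {x p : EuclideanSpace ℝ (Fin 3)} {c s L : ℝ} (hc : 0 < c)
    (hs : 0 < s) (hsw : s ≤ w₀) (hcx : c < ‖x - p‖)
    (hL : L ≤ ∫ w in (‖x - p‖ - c)..(‖x - p‖ + c),
      Real.pi / ‖x - p‖ * w * (c ^ 2 - (w - ‖x - p‖) ^ 2) * θcut s w) :
    ENNReal.ofReal L ≤ ∫⁻ y in ball x c, ENNReal.ofReal (θcut s ‖y - p‖) := by
  set r := ‖x - p‖ with hr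
  have hw₀ : 0 < r := hc.trans hcx
  have hpre : ball x c = (fun y => y - p) ⁻¹' (ball (x - p) c) := by
    ext y; simp [mem_ball, dist_eq_norm]
  have hmp := measurePreserving_sub_right (volume : Measure (EuclideanSpace ℝ (Fin 3))) p
  have hmeas : Measurable fun y : EuclideanSpace ℝ (Fin 3) => ENNReal.ofReal (θcut s ‖y‖) :=
    ((measurable_θcut s).comp measurable_norm).ennreal_ofReal
  have hnn : ∀ w ∈ Icc (‖x - p‖ - c) (‖x - p‖ + c), 0 ≤ θcut s w := fun w _ => θcut_nonneg hs w
  have hint : IntegrableOn (θcut s) (Icc (‖x - p‖ - c) (‖x - p‖ + c)) :=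
    integrableOn_θcut_Icc hs hsw _ _
  calc ENNReal.ofReal L
      ≤ ENNReal.ofReal (∫ w in (r - c)..(r + c),
          Real.pi / r * w * (c ^ 2 - (w - r) ^ 2) * θcut s w) := ENNReal.ofReal_le_ofReal hL
    _ = ∫⁻ y in ball (x - p) c, ENNReal.ofReal (θcut s ‖y‖) :=
        (Literature.MeasureTheory.Lebesgue.setLIntegral_ball_radial_ofReal hc hcx
          (measurable_θcut s) hnn hint).symm
    _ = ∫⁻ y in ball x c, ENNReal.ofReal (θcut s ‖y - p‖) := by
        rw [hpre]
        exact (hmp.setLIntegral_comp_preimage measurableSet_ball hmeas).symm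

/-- **Prop. 4 integrated over an off-centre ball.** For `0 < c < ‖x - p‖` and a cut-off
`0 ≤ s ≤ ‖x - p‖ - c`: `|B(x,c)| θ(‖x - p‖) ≤ ∫_{B(x,c)} θ^{s}(‖y - p‖) dy` (hat-box formula +
convexity of `ψ`). [cite: Yuhjtman2015, Prop. 4] -/
theorem lintegral_ball_θcut_ge {x p : EuclideanSpace ℝ (Fin 3)} {c s : ℝ} (hc : 0 < c)
    (hs : 0 < s) (hsw : s ≤ w₀) (hcx : c < ‖x - p‖) (hsx : s ≤ ‖x - p‖ - c) :
    ENNReal.ofReal (4 * Real.pi / 3 * c ^ 3 * θ ‖x - p‖) ≤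
      ∫⁻ y in ball x c, ENNReal.ofReal (θcut s ‖y - p‖) :=
  lintegral_ball_ge_of_hatbox hc hs hsw hcx (ballIntegrand_θcut_ge hc hcx hs hsw hsx)

/-- **Packing bound (the method of Prop. 5 I).** If the points of `Q` are `2c`-separated and
every `q ∈ Q` has `‖q - p‖ ≥ s + c` (and `> c`), the balls `B(q, c)` are disjoint and avoid the
cut-off region, so `∑_{q ∈ Q} |B_c| θ(‖q - p‖) ≤ ∫_{ℝ³} θ^{s}(‖y‖) dy`.
[cite: Yuhjtman2015, Prop. 5 (proof of I)] -/
theorem sum_ball_θ_le_lintegral (Q : Finset (EuclideanSpace ℝ (Fin 3)))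
    (p : EuclideanSpace ℝ (Fin 3)) {c s : ℝ} (hc : 0 < c) (hs : 0 < s) (hsw : s ≤ w₀)
    (hsep : ∀ q ∈ Q, ∀ q' ∈ Q, q ≠ q' → 2 * c ≤ dist q q')
    (hfar : ∀ q ∈ Q, s + c ≤ ‖q - p‖) (hcx : ∀ q ∈ Q, c < ‖q - p‖) :
    ∑ q ∈ Q, ENNReal.ofReal (4 * Real.pi / 3 * c ^ 3 * θ ‖q - p‖) ≤
      ∫⁻ y : EuclideanSpace ℝ (Fin 3), ENNReal.ofReal (θcut s ‖y‖) := by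
  have hdisj : Set.PairwiseDisjoint (↑Q : Set (EuclideanSpace ℝ (Fin 3))) fun q => ball q c := by
    intro q hq q' hq' hne
    exact ball_disjoint_ball (by have := hsep q hq q' hq' hne; linarith)
  calc ∑ q ∈ Q, ENNReal.ofReal (4 * Real.pi / 3 * c ^ 3 * θ ‖q - p‖)
      ≤ ∑ q ∈ Q, ∫⁻ y in ball q c, ENNReal.ofReal (θcut s ‖y - p‖) :=
        Finset.sum_le_sum fun q hq =>
          lintegral_ball_θcut_ge hc hs hsw (hcx q hq) (by linarith [hfar q hq])
    _ = ∫⁻ y in ⋃ q ∈ Q, ball q c, ENNReal.ofReal (θcut s ‖y - p‖) :=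
        (lintegral_biUnion_finset hdisj (fun _ _ => measurableSet_ball) _).symm
    _ ≤ ∫⁻ y, ENNReal.ofReal (θcut s ‖y - p‖) := setLIntegral_le_lintegral _ _
    _ = ∫⁻ y, ENNReal.ofReal (θcut s ‖y‖) :=
        lintegral_sub_right_eq_self (fun y : EuclideanSpace ℝ (Fin 3) => ENNReal.ofReal (θcut s ‖y‖)) p

/-- Real-valued form of the packing bound: `∑_{q ∈ Q} θ(‖q - p‖) ≤ 3V/(4π c³)` whenever
`∫ θ^{s}(‖y‖) dy ≤ V`. [cite: Yuhjtman2015, Prop. 5 (I)] -/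
theorem sum_θ_le_of_lintegral_le (Q : Finset (EuclideanSpace ℝ (Fin 3)))
    (p : EuclideanSpace ℝ (Fin 3)) {c s V : ℝ} (hc : 0 < c) (hs : 0 < s) (hsw : s ≤ w₀) (hV : 0 ≤ V)
    (hsep : ∀ q ∈ Q, ∀ q' ∈ Q, q ≠ q' → 2 * c ≤ dist q q')
    (hfar : ∀ q ∈ Q, s + c ≤ ‖q - p‖) (hcx : ∀ q ∈ Q, c < ‖q - p‖)
    (hI : ∫⁻ y : EuclideanSpace ℝ (Fin 3), ENNReal.ofReal (θcut s ‖y‖) ≤ ENNReal.ofReal V) :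
    ∑ q ∈ Q, θ ‖q - p‖ ≤ 3 * V / (4 * Real.pi * c ^ 3) := by
  have h := (sum_ball_θ_le_lintegral Q p hc hs hsw hsep hfar hcx).trans hI
  have hnn : ∀ q ∈ Q, 0 ≤ 4 * Real.pi / 3 * c ^ 3 * θ ‖q - p‖ := fun q hq =>
    mul_nonneg (by positivity) (θ_nonneg (hc.trans (hcx q hq)))
  rw [← ENNReal.ofReal_sum_of_nonneg hnn, ENNReal.ofReal_le_ofReal_iff hV, ← Finset.mul_sum] at h
  rw [le_div_iff₀ (by positivity)]
  calc (∑ q ∈ Q, θ ‖q - p‖) * (4 * Real.pi * c ^ 3)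
      = 3 * (4 * Real.pi / 3 * c ^ 3 * ∑ q ∈ Q, θ ‖q - p‖) := by ring
    _ ≤ 3 * V := by linarith

/-! ### The total integrals `∫ θ^{s}(‖y‖) dy = 4π ∫_s^∞ θ(w) w² dw` -/

/-- `∫_c^∞ w⁻ⁿ dw = c^{1-n}/(n-1)` for `n ≥ 2`, `c > 0` (and integrability). [folklore] -/
theorem integral_Ioi_inv_pow {n : ℕ} (hn : 2 ≤ n) {c : ℝ} (hc : 0 < c) :
    IntegrableOn (fun w : ℝ => (w⁻¹) ^ n) (Ioi c) ∧
      ∫ w in Ioi c, (w⁻¹) ^ n = (c⁻¹) ^ (n - 1) / (n - 1) := by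
  have ha : (-(n : ℝ)) < -1 := by
    have : (2 : ℝ) ≤ n := by exact_mod_cast hn
    linarith
  have heq : EqOn (fun w : ℝ => w ^ (-(n : ℝ))) (fun w : ℝ => (w⁻¹) ^ n) (Ioi c) := by
    intro w hw
    have hw : 0 < w := hc.trans hw
    simp only
    rw [Real.rpow_neg hw.le, Real.rpow_natCast, inv_pow]
  refine ⟨(integrableOn_Ioi_rpow_of_lt ha hc).congr_fun heq measurableSet_Ioi, ?_⟩
  rw [← setIntegral_congr_fun measurableSet_Ioi heq, integral_Ioi_rpow_of_lt ha hc]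
  have hn1 : (1 : ℕ) ≤ n := le_trans (by norm_num) hn
  have e1 : -(n : ℝ) + 1 = -((n - 1 : ℕ) : ℝ) := by
    rw [Nat.cast_sub hn1, Nat.cast_one]; ring
  have e2 : ((n : ℝ) - 1) = ((n - 1 : ℕ) : ℝ) := by rw [Nat.cast_sub hn1, Nat.cast_one]
  rw [e1, Real.rpow_neg hc.le, Real.rpow_natCast, ← inv_pow, e2]
  have hpos : (0 : ℝ) < ((n - 1 : ℕ) : ℝ) := by
    have : 1 ≤ n - 1 := by omega
    exact_mod_cast this
  field_simp

/-- **Total mass of the cut-off majorant**: `∫_{ℝ³} θ^{s}(‖y‖) dy = 4π I(s)` for `0 < s ≤ r₀`.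
[cite: Yuhjtman2015, Prop. 5 (proof)] -/
theorem lintegral_θcut {s : ℝ} (hs0 : 0 < s) (hs : s ≤ w₀) :
    ∫⁻ y : EuclideanSpace ℝ (Fin 3), ENNReal.ofReal (θcut s ‖y‖) =
      ENNReal.ofReal (4 * Real.pi * (100 / 99 * w₀ ^ 3 - 180 / 121 * w₀ * s ^ 2 + 25 / 33 * s ^ 3)) := by
  have hr := w₀_pos
  have hrb := w₀_bounds6
  have hB : B = 25 / 11 := rfl
  have hmeas : Measurable fun w => ENNReal.ofReal (θcut s w) := (measurable_θcut s).ennreal_ofReal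
  rw [Literature.MeasureTheory.Lebesgue.lintegral_radial_three _ hmeas]
  have hcomb : EqOn (fun w => ENNReal.ofReal (4 * Real.pi * w ^ 2) * ENNReal.ofReal (θcut s w))
      (fun w => ENNReal.ofReal (4 * Real.pi * w ^ 2 * θcut s w)) (Ioi 0) := fun w _ => by
    simp only; rw [← ENNReal.ofReal_mul (by positivity)]
  rw [setLIntegral_congr_fun measurableSet_Ioi hcomb, ← Ioc_union_Ioi_eq_Ioi hr.le,
    lintegral_union measurableSet_Ioi Ioc_disjoint_Ioi_same]
  -- piece 1: `(0, r₀]`, where `θ = ℓ/w`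
  have h1 : ∫⁻ w in Ioc 0 w₀, ENNReal.ofReal (4 * Real.pi * w ^ 2 * θcut s w) =
      ENNReal.ofReal (4 * Real.pi * (A * (w₀ ^ 2 - s ^ 2) / 2 - 25 / 33 * (w₀ ^ 3 - s ^ 3))) := by
    have heq : EqOn (fun w => ENNReal.ofReal (4 * Real.pi * w ^ 2 * θcut s w))
        ((Ici s).indicator fun w => ENNReal.ofReal (4 * Real.pi * (A * w - 25 / 11 * w ^ 2)))
        (Ioc 0 w₀) := by
      intro w hw
      simp only [θcut, indicator, mem_Ici]
      split_ifs with hsw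
      · rw [θ_of_le hw.2, hB]
        congr 1
        field_simp [hw.1.ne']
      · simp
    rw [setLIntegral_congr_fun measurableSet_Ioc heq, lintegral_indicator measurableSet_Ici,
      Measure.restrict_restrict measurableSet_Ici,
      show Ici s ∩ Ioc 0 w₀ = Icc s w₀ by
        ext w; simp only [mem_inter_iff, mem_Ici, mem_Ioc, mem_Icc]
        constructor
        · rintro ⟨h1, -, h2⟩; exact ⟨h1, h2⟩
        · rintro ⟨h1, h2⟩; exact ⟨h1, hs0.trans_le h1, h2⟩]
    have hnn : ∀ w ∈ Icc s w₀, 0 ≤ 4 * Real.pi * (A * w - 25 / 11 * w ^ 2) := by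
      intro w hw
      have hw0 : 0 ≤ w := hs0.le.trans hw.1
      have : 0 ≤ A * w - 25 / 11 * w ^ 2 := by
        have h' : 25 / 11 * w ≤ A := by unfold A; linarith [hw.2]
        nlinarith
      positivity
    have hint : IntegrableOn (fun w => 4 * Real.pi * (A * w - 25 / 11 * w ^ 2)) (Icc s w₀) :=
      Continuous.integrableOn_Icc (by fun_prop)
    rw [← ofReal_integral_eq_lintegral_ofReal hint
      ((ae_restrict_iff' measurableSet_Icc).2 (Filter.Eventually.of_forall hnn)),
      integral_Icc_eq_integral_Ioc, ← intervalIntegral.integral_of_le hs]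
    congr 1
    rw [intervalIntegral.integral_const_mul, intervalIntegral.integral_sub,
      intervalIntegral.integral_const_mul, intervalIntegral.integral_const_mul, integral_id,
      integral_pow]
    · ring
    all_goals
      apply Continuous.intervalIntegrable
      fun_prop
  -- piece 2: `(r₀, ∞)`, where `θ = h`
  have h2 : ∫⁻ w in Ioi w₀, ENNReal.ofReal (4 * Real.pi * w ^ 2 * θcut s w) =
      ENNReal.ofReal (4 * Real.pi * (305 / 1089 * w₀ ^ 3)) := by
    have heq : EqOn (fun w => ENNReal.ofReal (4 * Real.pi * w ^ 2 * θcut s w))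
        (fun w => ENNReal.ofReal (4 * Real.pi * (-(w⁻¹) ^ 10 + 2 * (w⁻¹) ^ 4))) (Ioi w₀) := by
      intro w hw
      have hw0 : 0 < w := hr.trans hw
      have hsw : s ≤ w := hs.trans hw.le
      simp only [θcut, if_pos hsw]
      rw [θ_of_lt hw]
      unfold hLJ
      congr 1
      have e10 : w ^ 2 * (w⁻¹) ^ 12 = (w⁻¹) ^ 10 := by
        rw [show (w⁻¹) ^ 12 = (w⁻¹) ^ 2 * (w⁻¹) ^ 10 by rw [← pow_add], ← mul_assoc, ← mul_pow,
          mul_inv_cancel₀ hw0.ne', one_pow, one_mul]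
      have e4 : w ^ 2 * (w⁻¹) ^ 6 = (w⁻¹) ^ 4 := by
        rw [show (w⁻¹) ^ 6 = (w⁻¹) ^ 2 * (w⁻¹) ^ 4 by rw [← pow_add], ← mul_assoc, ← mul_pow,
          mul_inv_cancel₀ hw0.ne', one_pow, one_mul]
      rw [show 4 * Real.pi * w ^ 2 * (2 * (w⁻¹) ^ 6 - (w⁻¹) ^ 12) =
        4 * Real.pi * (2 * (w ^ 2 * (w⁻¹) ^ 6) - w ^ 2 * (w⁻¹) ^ 12) by ring, e10, e4]
      ring
    rw [setLIntegral_congr_fun measurableSet_Ioi heq]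
    obtain ⟨hi10, hv10⟩ := integral_Ioi_inv_pow (by norm_num : 2 ≤ 10) hr
    obtain ⟨hi4, hv4⟩ := integral_Ioi_inv_pow (by norm_num : 2 ≤ 4) hr
    have hnn : ∀ w ∈ Ioi w₀, 0 ≤ 4 * Real.pi * (-(w⁻¹) ^ 10 + 2 * (w⁻¹) ^ 4) := by
      intro w hw
      have hw0 : 0 < w := hr.trans hw
      have hi : 0 < w⁻¹ := inv_pos.2 hw0
      have hu : (w⁻¹) ^ 6 ≤ 5 / 11 := by
        rw [← inv_w₀_pow_six]
        exact pow_le_pow_left₀ hi.le ((inv_le_inv₀ hw0 hr).2 hw.le) 6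
      have : 0 ≤ -(w⁻¹) ^ 10 + 2 * (w⁻¹) ^ 4 := by
        have e : -(w⁻¹) ^ 10 + 2 * (w⁻¹) ^ 4 = (w⁻¹) ^ 4 * (2 - (w⁻¹) ^ 6) := by ring
        rw [e]; exact mul_nonneg (pow_nonneg hi.le 4) (by linarith)
      positivity
    have hint : IntegrableOn (fun w => 4 * Real.pi * (-(w⁻¹) ^ 10 + 2 * (w⁻¹) ^ 4)) (Ioi w₀) :=
      (hi10.neg.add (hi4.const_mul 2)).const_mul (4 * Real.pi)
    rw [← ofReal_integral_eq_lintegral_ofReal hint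
      ((ae_restrict_iff' measurableSet_Ioi).2 (Filter.Eventually.of_forall hnn)),
      integral_const_mul,
      integral_add (show Integrable (fun a : ℝ => -(a⁻¹) ^ 10) (volume.restrict (Ioi w₀)) from hi10.neg)
        (show Integrable (fun a : ℝ => 2 * (a⁻¹) ^ 4) (volume.restrict (Ioi w₀)) from hi4.const_mul 2),
      integral_neg, integral_const_mul, hv10, hv4]
    congr 1
    have h3 : (w₀⁻¹) ^ 3 = 5 / 11 * w₀ ^ 3 := by
      have e : (w₀⁻¹) ^ 3 = w₀ ^ 3 * (w₀⁻¹) ^ 6 := by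
        rw [show (w₀⁻¹) ^ 6 = (w₀⁻¹) ^ 3 * (w₀⁻¹) ^ 3 by rw [← pow_add], ← mul_assoc,
          ← mul_pow, mul_inv_cancel₀ hr.ne', one_pow, one_mul]
      rw [e, inv_w₀_pow_six]; ring
    have h9 : (w₀⁻¹) ^ 9 = 25 / 121 * w₀ ^ 3 := by
      rw [show (w₀⁻¹) ^ 9 = (w₀⁻¹) ^ 3 * (w₀⁻¹) ^ 6 by rw [← pow_add], h3, inv_w₀_pow_six]; ring
    norm_num
    rw [← inv_pow, ← inv_pow, h3, h9]
    ring
  rw [h1, h2, ← ENNReal.ofReal_add]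
  · congr 1
    unfold A
    ring
  · have : 0 ≤ A * (w₀ ^ 2 - s ^ 2) / 2 - 25 / 33 * (w₀ ^ 3 - s ^ 3) := by
      -- `= ∫_s^{r₀} w (A - 25w/11) dw ≥ 0`; directly: factor `(r₀ - s)`
      have hs' : 0 ≤ w₀ - s := by linarith
      have e : A * (w₀ ^ 2 - s ^ 2) / 2 - 25 / 33 * (w₀ ^ 3 - s ^ 3) =
          (w₀ - s) * (A * (w₀ + s) / 2 - 25 / 33 * (w₀ ^ 2 + w₀ * s + s ^ 2)) := by ring
      rw [e]
      refine mul_nonneg hs' ?_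
      unfold A
      nlinarith [mul_nonneg hs0.le hs', mul_nonneg hr.le hs']
    positivity
  · positivity

/-! ### Prop. 8: balls of radius `0.49` centred at distance `r ∈ [0.51, 1.03]` from the pole -/

/-- Lower bound for the hat-box integral of `θ^{s}` by the harmonic part `ℓ(w)/w ≤ θ(w)` on a
window `[s, w₂] ⊆ [r - c, r + c]` (the device of Prop. 5 II and Prop. 8, regions 2–3: integrate
`θ^{s}` in spherical shells and keep only the shells `s ≤ w ≤ w₂`, where `θ ≥ t`).
[cite: Yuhjtman2015, Prop. 8 (proof)] -/
theorem ballIntegrand_window_le {r c s w₂ : ℝ} (hc : 0 < c) (hcr : c < r) (hs1 : r - c ≤ s)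
    (hsw₀ : s ≤ w₀) (hsw : s ≤ w₂) (hw2 : w₂ ≤ r + c) :
    Real.pi / r * ∫ w in s..w₂, (c ^ 2 - (w - r) ^ 2) * (A - B * w) ≤
      ∫ w in (r - c)..(r + c), Real.pi / r * w * (c ^ 2 - (w - r) ^ 2) * θcut s w := by
  have hr : 0 < r := hc.trans hcr
  have hs0 : 0 < s := lt_of_lt_of_le (by linarith) hs1
  set f : ℝ → ℝ := fun w => Real.pi / r * w * (c ^ 2 - (w - r) ^ 2) * θcut s w with hf
  -- integrability of `f` on `[r - c, r + c]` and its sub-intervals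
  have hfi : IntervalIntegrable f volume (r - c) (r + c) :=
    (intervalIntegrable_θcut hs0 hsw₀ (r - c) (r + c)).continuousOn_mul
      (by fun_prop : Continuous fun w : ℝ => Real.pi / r * w * (c ^ 2 - (w - r) ^ 2)).continuousOn
  have hsub1 : uIcc (r - c) s ⊆ uIcc (r - c) (r + c) := by
    rw [uIcc_of_le hs1, uIcc_of_le (by linarith)]; exact Icc_subset_Icc le_rfl (by linarith)
  have hsub2 : uIcc s w₂ ⊆ uIcc (r - c) (r + c) := by
    rw [uIcc_of_le hsw, uIcc_of_le (by linarith)]; exact Icc_subset_Icc hs1 hw2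
  have hsub3 : uIcc w₂ (r + c) ⊆ uIcc (r - c) (r + c) := by
    rw [uIcc_of_le hw2, uIcc_of_le (by linarith)]; exact Icc_subset_Icc (by linarith) le_rfl
  have hf1 := hfi.mono_set hsub1
  have hf2 := hfi.mono_set hsub2
  have hf3 := hfi.mono_set hsub3
  -- non-negativity of `f` on `[r - c, r + c]`
  have hf0 : ∀ w ∈ Icc (r - c) (r + c), 0 ≤ f w := by
    intro w hw
    have hw0 : 0 < w := lt_of_lt_of_le (by linarith) hw.1
    have hK : 0 ≤ c ^ 2 - (w - r) ^ 2 := by nlinarith [hw.1, hw.2]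
    have hθ : 0 ≤ θcut s w := θcut_nonneg hs0 w
    rw [hf]
    positivity
  -- split the integral
  have hsplit : ∫ w in (r - c)..(r + c), f w =
      (∫ w in (r - c)..s, f w) + ((∫ w in s..w₂, f w) + ∫ w in w₂..(r + c), f w) := by
    rw [intervalIntegral.integral_add_adjacent_intervals hf2 hf3,
      intervalIntegral.integral_add_adjacent_intervals hf1 (hf2.trans hf3)]
  have hI1 : 0 ≤ ∫ w in (r - c)..s, f w :=
    intervalIntegral.integral_nonneg hs1 fun w hw => hf0 w ⟨hw.1, by linarith [hw.2]⟩
  have hI3 : 0 ≤ ∫ w in w₂..(r + c), f w :=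
    intervalIntegral.integral_nonneg hw2 fun w hw => hf0 w ⟨by linarith [hw.1], hw.2⟩
  -- compare on the window
  have hg : IntervalIntegrable (fun w => Real.pi / r * ((c ^ 2 - (w - r) ^ 2) * (A - B * w)))
      volume s w₂ := by
    apply Continuous.intervalIntegrable
    fun_prop
  have hI2 : ∫ w in s..w₂, Real.pi / r * ((c ^ 2 - (w - r) ^ 2) * (A - B * w)) ≤
      ∫ w in s..w₂, f w := by
    refine intervalIntegral.integral_mono_on hsw hg hf2 fun w hw => ?_
    have hw0 : 0 < w := hs0.trans_le hw.1
    have hK : 0 ≤ c ^ 2 - (w - r) ^ 2 := by nlinarith [hw.1, hw.2, hs1, hw2]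
    have hθ : θcut s w = θ w := θcut_of_le hw.1
    rw [hf]
    simp only
    rw [hθ, show Real.pi / r * w * (c ^ 2 - (w - r) ^ 2) * θ w =
      Real.pi / r * ((c ^ 2 - (w - r) ^ 2) * gθ w) by unfold gθ; ring]
    exact mul_le_mul_of_nonneg_left (mul_le_mul_of_nonneg_left (line_le_gθ hw0) hK) (by positivity)
  rw [intervalIntegral.integral_const_mul] at hI2
  change Real.pi / r * ∫ w in s..w₂, (c ^ 2 - (w - r) ^ 2) * (A - B * w) ≤
    ∫ w in (r - c)..(r + c), f w
  rw [hsplit]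
  linarith

/-- The window integral in closed form (a cubic polynomial in `w`, integrated termwise).
[cite: Yuhjtman2015, Prop. 5 (proof of II)] -/
theorem integral_weight_line (r c s w₂ : ℝ) :
    ∫ w in s..w₂, (c ^ 2 - (w - r) ^ 2) * (A - B * w) =
      A * ((c ^ 2 - r ^ 2) * (w₂ - s) + r * (w₂ ^ 2 - s ^ 2) - (w₂ ^ 3 - s ^ 3) / 3) -
        25 / 11 * ((c ^ 2 - r ^ 2) * (w₂ ^ 2 - s ^ 2) / 2 + 2 * r * (w₂ ^ 3 - s ^ 3) / 3 -
          (w₂ ^ 4 - s ^ 4) / 4) := by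
  have e : ∀ w, (c ^ 2 - (w - r) ^ 2) * (A - B * w) =
      A * (c ^ 2 - r ^ 2) + (2 * A * r - 25 / 11 * (c ^ 2 - r ^ 2)) * w -
        (A + 50 / 11 * r) * w ^ 2 + 25 / 11 * w ^ 3 := by
    intro w; unfold B; ring
  simp_rw [e]
  rw [intervalIntegral.integral_add, intervalIntegral.integral_sub, intervalIntegral.integral_add,
    intervalIntegral.integral_const, intervalIntegral.integral_const_mul,
    intervalIntegral.integral_const_mul, intervalIntegral.integral_const_mul, integral_id,
    integral_pow, integral_pow]
  · simp only [smul_eq_mul]; ring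
  all_goals
    apply Continuous.intervalIntegrable
    fun_prop

/-- A rational lower bound for `A = (360/121) r₀`. [cite: Yuhjtman2015, Prop. 3] -/
theorem A_lower : (360 / 121 * (114043 / 100000) : ℝ) ≤ A := by
  unfold A; linarith [w₀_bounds6.1]

/-- **Prop. 8, region 2** (`0.51 ≤ r ≤ 0.9`, window `[0.54, 1]`): the average of `θ^{0.54}` over
`B(x, 0.49)`, `‖x‖ = r`, is at least `1` (`≥ h̃(r)`). [cite: Yuhjtman2015, Prop. 8 (region 2)] -/
theorem ballIntegrand_region2 {r : ℝ} (hr1 : 51 / 100 ≤ r) (hr2 : r ≤ 9 / 10) :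
    4 * Real.pi / 3 * (49 / 100) ^ 3 ≤
      ∫ w in (r - 49 / 100)..(r + 49 / 100),
        Real.pi / r * w * ((49 / 100) ^ 2 - (w - r) ^ 2) * θcut (27 / 50) w := by
  have hw₀ : 0 < r := by linarith
  refine le_trans ?_ (ballIntegrand_window_le (c := 49 / 100) (s := 27 / 50) (w₂ := 1)
    (by norm_num) (by linarith) (by linarith) (by linarith [w₀_bounds6.1]) (by norm_num) (by linarith))
  rw [integral_weight_line, show 4 * Real.pi / 3 * (49 / 100 : ℝ) ^ 3 =
    Real.pi / r * (4 / 3 * (49 / 100) ^ 3 * r) by field_simp]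
  refine mul_le_mul_of_nonneg_left ?_ (by positivity)
  have hA := A_lower
  have hprod : 0 ≤ (r - 51 / 100) * (9 / 10 - r) := mul_nonneg (by linarith) (by linarith)
  -- the coefficient of `A` is non-negative on the region
  have hα : (0 : ℝ) ≤ ((49 / 100) ^ 2 - r ^ 2) * (1 - 27 / 50) + r * (1 ^ 2 - (27 / 50) ^ 2) -
      (1 ^ 3 - (27 / 50) ^ 3) / 3 := by nlinarith
  nlinarith [mul_le_mul_of_nonneg_right hA hα]

/-- **Prop. 8, region 3** (`0.9 ≤ r ≤ 1.03`, window `[0.54, 1.39]`, using `h ≥ t > 0` up to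
`1.49`): the average of `θ^{0.54}` over `B(x, 0.49)`, `‖x‖ = r`, is at least `1`.
[cite: Yuhjtman2015, Prop. 8 (region 3)] -/
theorem ballIntegrand_region3 {r : ℝ} (hr1 : 9 / 10 ≤ r) (hr2 : r ≤ 103 / 100) :
    4 * Real.pi / 3 * (49 / 100) ^ 3 ≤
      ∫ w in (r - 49 / 100)..(r + 49 / 100),
        Real.pi / r * w * ((49 / 100) ^ 2 - (w - r) ^ 2) * θcut (27 / 50) w := by
  have hw₀ : 0 < r := by linarith
  refine le_trans ?_ (ballIntegrand_window_le (c := 49 / 100) (s := 27 / 50) (w₂ := 139 / 100)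
    (by norm_num) (by linarith) (by linarith) (by linarith [w₀_bounds6.1]) (by norm_num)
    (by linarith))
  rw [integral_weight_line, show 4 * Real.pi / 3 * (49 / 100 : ℝ) ^ 3 =
    Real.pi / r * (4 / 3 * (49 / 100) ^ 3 * r) by field_simp]
  refine mul_le_mul_of_nonneg_left ?_ (by positivity)
  have hA := A_lower
  have hprod : 0 ≤ (r - 9 / 10) * (103 / 100 - r) := mul_nonneg (by linarith) (by linarith)
  have hα : (0 : ℝ) ≤ ((49 / 100) ^ 2 - r ^ 2) * (139 / 100 - 27 / 50) +
      r * ((139 / 100) ^ 2 - (27 / 50) ^ 2) - ((139 / 100) ^ 3 - (27 / 50) ^ 3) / 3 := by nlinarith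
  nlinarith [mul_le_mul_of_nonneg_right hA hα]

/-- **Prop. 8 (all regions).** For `c = 0.49`, cut-off `0.54` and `0.51 ≤ r`:
`∫ (hat-box integrand) θ^{0.54} ≥ |B| · min(1, θ(r))`-type bound, in the form used below:
the right-hand side dominates `|B| · 1` for `r ≤ 1.03` and `|B| θ(r)` for `r > 1.03`.
[cite: Yuhjtman2015, Prop. 8] -/
theorem ballIntegrand_prop8 {r : ℝ} (hr1 : 51 / 100 ≤ r) :
    4 * Real.pi / 3 * (49 / 100) ^ 3 * (if r ≤ 103 / 100 then 1 else θ r) ≤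
      ∫ w in (r - 49 / 100)..(r + 49 / 100),
        Real.pi / r * w * ((49 / 100) ^ 2 - (w - r) ^ 2) * θcut (27 / 50) w := by
  split_ifs with h
  · rw [mul_one]
    rcases le_total r (9 / 10) with h9 | h9
    · exact ballIntegrand_region2 hr1 h9
    · exact ballIntegrand_region3 h9 h
  · push Not at h
    exact ballIntegrand_θcut_ge (by norm_num) (by linarith) (by norm_num) (by linarith [w₀_bounds6.1])
      (by linarith)

/-! ### Numerical constants -/

/-- `I(0.54) ≤ 1.12282` (true value `≈ 1.122809`; Yuhjtman: `24 I(0.54) < 26.95` and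
`12 I(0.54)/0.98³ < 14.316`). [cite: Yuhjtman2015, Prop. 5 (I), Thm. 9 (proof)] -/
theorem Ival_054_le :
    (100 / 99 * w₀ ^ 3 - 180 / 121 * w₀ * (27 / 50) ^ 2 + 25 / 33 * (27 / 50) ^ 3) ≤
      112282 / 100000 := by
  have hb := w₀_bounds6
  have hr := w₀_pos
  have h3 : w₀ ^ 3 ≤ (1140435 / 1000000 : ℝ) ^ 3 := pow_le_pow_left₀ hr.le hb.2.le 3
  nlinarith

/-- `I(0.2) ≤ 3/2` (indeed `I(0) = (100/99) r₀³ < 1.5`; Yuhjtman: `24 ∫_0^∞ θ r² dr < 36`).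
[cite: Yuhjtman2015, Thm. 9 (proof)] -/
theorem Ival_02_le :
    (100 / 99 * w₀ ^ 3 - 180 / 121 * w₀ * (1 / 5) ^ 2 + 25 / 33 * (1 / 5) ^ 3) ≤ 3 / 2 := by
  have hb := w₀_bounds6
  have hr := w₀_pos
  have h3 : w₀ ^ 3 ≤ (1140435 / 1000000 : ℝ) ^ 3 := pow_le_pow_left₀ hr.le hb.2.le 3
  nlinarith

/-- `0 ≤ I(s)` for `0 ≤ s ≤ r₀` (it is an integral of a non-negative function; directly from the
closed form). [cite: Yuhjtman2015, Prop. 5] -/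
theorem Ival_nonneg {s : ℝ} (hs0 : 0 ≤ s) (hs : s ≤ w₀) :
    0 ≤ (100 / 99 * w₀ ^ 3 - 180 / 121 * w₀ * s ^ 2 + 25 / 33 * s ^ 3) := by
  have hb := w₀_bounds6
  have hr := w₀_pos
  have h1 : s ^ 2 ≤ w₀ ^ 2 := pow_le_pow_left₀ hs0 hs 2
  nlinarith [mul_nonneg hr.le (sub_nonneg.2 h1), pow_nonneg hs0 3, pow_pos hr 3]

/-- **The closest-pair inequality** (the method of Prop. 6 / Cor. 7 with the bound of Prop. 5 I):
for `0 < a ≤ 0.67`, `h(a) + 24 I(0.54)/a³ < 0`, i.e. `2a⁶ + 24 I(0.54) a⁹ < 1`; hence a particle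
at distance `a` from its nearest neighbour in an `a`-separated configuration has negative
minus-energy. (Yuhjtman: `2a⁶ + 26.95a⁹ < 1` for `a < 0.65`, and `24.05a⁹ + 2a⁶ ≥ 1` fails for
`a ≤ 0.684` using the sharper Prop. 5 II; we use the threshold `0.67` with Prop. 5 I only.)
[cite: Yuhjtman2015, Prop. 6 (proof), Cor. 7] -/
theorem closePair_neg {a : ℝ} (ha0 : 0 < a) (ha : a ≤ 67 / 100) :
    hLJ a + 24 * (100 / 99 * w₀ ^ 3 - 180 / 121 * w₀ * (27 / 50) ^ 2 + 25 / 33 * (27 / 50) ^ 3) / a ^ 3 < 0 := by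
  have hI := Ival_054_le
  have hI0 : 0 ≤ (100 / 99 * w₀ ^ 3 - 180 / 121 * w₀ * (27 / 50) ^ 2 + 25 / 33 * (27 / 50) ^ 3) :=
    Ival_nonneg (by norm_num) (by linarith [w₀_bounds6.1])
  have h6 : a ^ 6 ≤ (67 / 100 : ℝ) ^ 6 := pow_le_pow_left₀ ha0.le ha 6
  have h9 : a ^ 9 ≤ (67 / 100 : ℝ) ^ 9 := pow_le_pow_left₀ ha0.le ha 9
  have key : a ^ 12 * (hLJ a + 24 * (100 / 99 * w₀ ^ 3 - 180 / 121 * w₀ * (27 / 50) ^ 2 + 25 / 33 * (27 / 50) ^ 3) / a ^ 3) =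
      -1 + 2 * a ^ 6 + 24 * (100 / 99 * w₀ ^ 3 - 180 / 121 * w₀ * (27 / 50) ^ 2 + 25 / 33 * (27 / 50) ^ 3) * a ^ 9 := by
    unfold hLJ
    field_simp
    ring
  have hneg : -1 + 2 * a ^ 6 +
      24 * (100 / 99 * w₀ ^ 3 - 180 / 121 * w₀ * (27 / 50) ^ 2 + 25 / 33 * (27 / 50) ^ 3) * a ^ 9 < 0 := by
    nlinarith [mul_le_mul_of_nonneg_left h9 (by positivity : (0 : ℝ) ≤
      24 * (100 / 99 * w₀ ^ 3 - 180 / 121 * w₀ * (27 / 50) ^ 2 + 25 / 33 * (27 / 50) ^ 3))]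
  by_contra h
  have : 0 ≤ a ^ 12 * (hLJ a +
      24 * (100 / 99 * w₀ ^ 3 - 180 / 121 * w₀ * (27 / 50) ^ 2 + 25 / 33 * (27 / 50) ^ 3) / a ^ 3) :=
    mul_nonneg (by positivity) (not_lt.1 h)
  rw [key] at this
  linarith

/-! ### The Appendix inequality (with `K = 120`) -/

/-- One cell of the table: on `[lo, hi] ⊆ (0, 0.98]` the left side is at most its value with
`(0.98 - lo)²(hi + 1.96)` and `2((hi⁻⁶) - 1)² ≤ 2((d⁻⁶) - 1)² = 2(1 - h(d))`.
[cite: Yuhjtman2015, Appendix] -/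
theorem appendix_cell {d lo hi : ℝ} (hlo : lo ≤ d) (hhi : d ≤ hi) (h0 : 0 < lo) (h98 : hi ≤ 98 / 100)
    (hnum : 120 * ((98 / 100 - lo) ^ 2 * (hi + 196 / 100)) / (16 * (49 / 100) ^ 3) ≤
      2 * ((hi⁻¹) ^ 6 - 1) ^ 2) :
    120 * ((98 / 100 - d) ^ 2 * (d + 196 / 100)) / (16 * (49 / 100) ^ 3) + 2 * (hLJ d - 1) ≤ 0 := by
  have hd0 : 0 < d := h0.trans_le hlo
  have hhi0 : 0 < hi := hd0.trans_le hhi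
  have e : hLJ d - 1 = -((d⁻¹) ^ 6 - 1) ^ 2 := by unfold hLJ; ring
  have h1 : (98 / 100 - d) ^ 2 * (d + 196 / 100) ≤ (98 / 100 - lo) ^ 2 * (hi + 196 / 100) := by
    have ha : 0 ≤ 98 / 100 - d := by linarith
    have hb : (98 / 100 - d) ^ 2 ≤ (98 / 100 - lo) ^ 2 := pow_le_pow_left₀ ha (by linarith) 2
    exact mul_le_mul hb (by linarith) (by linarith) (by positivity)
  have h2 : ((hi⁻¹) ^ 6 - 1) ^ 2 ≤ ((d⁻¹) ^ 6 - 1) ^ 2 := by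
    have hinv : hi⁻¹ ≤ d⁻¹ := (inv_le_inv₀ hhi0 hd0).2 hhi
    have hone : 1 ≤ hi⁻¹ := (one_le_inv₀ hhi0).2 (by linarith)
    have hp : (hi⁻¹) ^ 6 ≤ (d⁻¹) ^ 6 := pow_le_pow_left₀ (by positivity) hinv 6
    have hp1 : 1 ≤ (hi⁻¹) ^ 6 := one_le_pow₀ hone
    exact pow_le_pow_left₀ (by linarith) (by linarith) 2
  have h3 : 120 * ((98 / 100 - d) ^ 2 * (d + 196 / 100)) / (16 * (49 / 100) ^ 3) ≤
      120 * ((98 / 100 - lo) ^ 2 * (hi + 196 / 100)) / (16 * (49 / 100) ^ 3) := by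
    have : (0 : ℝ) < 16 * (49 / 100) ^ 3 := by norm_num
    exact div_le_div_of_nonneg_right (by linarith) this.le
  rw [e]
  linarith

/-- **The Appendix inequality** (with our constant `K = 120` in place of `113`): for
`0.67 ≤ d ≤ 0.98`, `K · vol(N_d)/|B| + 2 (h(d) - 1) ≤ 0`, where
`vol(N_d)/|B| = (0.98 - d)²(d + 1.96)/(16 · 0.49³)` is the relative volume of the lens
`B(y, 0.49) ∩ B(z, 0.49)`, `‖y - z‖ = d`. Proved by a certified table over 15 sub-intervals
(monotone bounds on each; Yuhjtman instead bounds `P'` via Sturm-type root isolation).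
[cite: Yuhjtman2015, Appendix] -/
theorem appendix_ineq {d : ℝ} (hd1 : 67 / 100 ≤ d) (hd2 : d ≤ 98 / 100) :
    120 * ((98 / 100 - d) ^ 2 * (d + 196 / 100)) / (16 * (49 / 100) ^ 3) + 2 * (hLJ d - 1) ≤ 0 := by
  rcases le_or_gt d (1593 / 2000) with h0 | h0
  · exact appendix_cell hd1 h0 (by norm_num) (by norm_num) (by norm_num)
  rcases le_or_gt d (1691 / 2000) with h1 | h1
  · exact appendix_cell h0.le h1 (by norm_num) (by norm_num) (by norm_num)
  rcases le_or_gt d (1743 / 2000) with h2 | h2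
  · exact appendix_cell h1.le h2 (by norm_num) (by norm_num) (by norm_num)
  rcases le_or_gt d (111 / 125) with h3 | h3
  · exact appendix_cell h2.le h3 (by norm_num) (by norm_num) (by norm_num)
  rcases le_or_gt d (9 / 10) with h4 | h4
  · exact appendix_cell h3.le h4 (by norm_num) (by norm_num) (by norm_num)
  rcases le_or_gt d (1819 / 2000) with h5 | h5
  · exact appendix_cell h4.le h5 (by norm_num) (by norm_num) (by norm_num)
  rcases le_or_gt d (367 / 400) with h6 | h6
  · exact appendix_cell h5.le h6 (by norm_num) (by norm_num) (by norm_num)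
  rcases le_or_gt d (1849 / 2000) with h7 | h7
  · exact appendix_cell h6.le h7 (by norm_num) (by norm_num) (by norm_num)
  rcases le_or_gt d (931 / 1000) with h8 | h8
  · exact appendix_cell h7.le h8 (by norm_num) (by norm_num) (by norm_num)
  rcases le_or_gt d (15 / 16) with h9 | h9
  · exact appendix_cell h8.le h9 (by norm_num) (by norm_num) (by norm_num)
  rcases le_or_gt d (118 / 125) with h10 | h10
  · exact appendix_cell h9.le h10 (by norm_num) (by norm_num) (by norm_num)
  rcases le_or_gt d (1903 / 2000) with h11 | h11
  · exact appendix_cell h10.le h11 (by norm_num) (by norm_num) (by norm_num)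
  rcases le_or_gt d (24 / 25) with h12 | h12
  · exact appendix_cell h11.le h12 (by norm_num) (by norm_num) (by norm_num)
  rcases le_or_gt d (1941 / 2000) with h13 | h13
  · exact appendix_cell h12.le h13 (by norm_num) (by norm_num) (by norm_num)
  exact appendix_cell h13.le hd2 (by norm_num) (by norm_num) (by norm_num)

/-! ### Assembly (Theorem 9): configurations as finite subsets of `ℝ³` -/

section Assembly

open scoped Classical

/-- Removing a point: `U_Q = U_{Q ∖ p} + 2 e_Q(p)`. [cite: Yuhjtman2015, Prop. 6 (proof)] -/
theorem UY_eq_UY_erase_add {Q : Finset (EuclideanSpace ℝ (Fin 3))} {p : EuclideanSpace ℝ (Fin 3)}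
    (hp : p ∈ Q) :
    (∑ p' ∈ Q, ∑ z ∈ Q.erase p', hLJ ‖z - p'‖) =
      (∑ p' ∈ Q.erase p, ∑ z ∈ (Q.erase p).erase p', hLJ ‖z - p'‖) +
        2 * (∑ z ∈ Q.erase p, hLJ ‖z - p‖) := by
  rw [← Finset.add_sum_erase Q _ hp]
  have h1 : ∀ q ∈ Q.erase p, (∑ z ∈ Q.erase q, hLJ ‖z - q‖) =
      hLJ ‖p - q‖ + (∑ z ∈ (Q.erase p).erase q, hLJ ‖z - q‖) := by
    intro q hq
    have hpq : p ≠ q := (Finset.ne_of_mem_erase hq).symm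
    rw [← Finset.add_sum_erase (Q.erase q) _ (Finset.mem_erase.2 ⟨hpq, hp⟩),
      Finset.erase_right_comm]
  rw [Finset.sum_congr rfl h1, Finset.sum_add_distrib]
  have h2 : ∑ q ∈ Q.erase p, hLJ ‖p - q‖ = (∑ z ∈ Q.erase p, hLJ ‖z - p‖) :=
    Finset.sum_congr rfl fun q _ => by rw [norm_sub_rev]
  rw [h2]
  ring

/-- With at most one point there is no interaction: `U_Q = 0`. [folklore] -/
theorem UY_eq_zero_of_card_le_one {Q : Finset (EuclideanSpace ℝ (Fin 3))} (h : Q.card ≤ 1) :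
    (∑ p' ∈ Q, ∑ z ∈ Q.erase p', hLJ ‖z - p'‖) = 0 := by
  refine Finset.sum_eq_zero fun p hp => Finset.sum_eq_zero fun q hq => ?_
  exfalso
  have : 1 < Q.card := Finset.one_lt_card.2 ⟨q, Finset.mem_of_mem_erase hq, p, hp,
    Finset.ne_of_mem_erase hq⟩
  omega

/-! #### The `K`-bound: `∑_{p ∈ Q} θ^{0.54}(‖y - p‖) ≤ 120` for `0.67`-separated `Q` -/

/-- **Control of the translates of `Θ^{0.54}`** (Thm. 9, proof: "`∑_x Θ^{0.54}_x(w) < 113`"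
there, with minimal distance `0.684`): for a `0.67`-separated configuration and every point
`y`, `∑_{p ∈ Q} θ^{0.54}(‖y - p‖) ≤ 120` (balls of radius `0.335` about the points at distance
`≥ 0.54` from `y`, cut-off `0.2`, `24 I(0.2)/0.67³ < 120`). [cite: Yuhjtman2015, Thm. 9 (proof)] -/
theorem sum_θcut_le_K (Q : Finset (EuclideanSpace ℝ (Fin 3)))
    (hsep : ∀ q ∈ Q, ∀ q' ∈ Q, q ≠ q' → 67 / 100 ≤ dist q q') (y : EuclideanSpace ℝ (Fin 3)) :
    ∑ p ∈ Q, θcut (27 / 50) ‖y - p‖ ≤ 120 := by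
  set S := Q.filter fun p => 27 / 50 ≤ ‖p - y‖ with hS
  have h1 : ∑ p ∈ Q, θcut (27 / 50) ‖y - p‖ = ∑ p ∈ S, θ ‖p - y‖ := by
    rw [hS, Finset.sum_filter]
    refine Finset.sum_congr rfl fun p _ => ?_
    rw [norm_sub_rev]
    simp only [θcut]
  rw [h1]
  have hV : ∫⁻ z : EuclideanSpace ℝ (Fin 3), ENNReal.ofReal (θcut (1 / 5) ‖z‖) ≤
      ENNReal.ofReal (4 * Real.pi * (100 / 99 * w₀ ^ 3 - 180 / 121 * w₀ * (1 / 5) ^ 2 + 25 / 33 * (1 / 5) ^ 3)) :=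
    (lintegral_θcut (by norm_num) (by linarith [w₀_bounds6.1])).le
  have hI0 : 0 ≤ (100 / 99 * w₀ ^ 3 - 180 / 121 * w₀ * (1 / 5) ^ 2 + 25 / 33 * (1 / 5) ^ 3) :=
    Ival_nonneg (by norm_num) (by linarith [w₀_bounds6.1])
  have h2 := sum_θ_le_of_lintegral_le S y (c := 67 / 200) (s := 1 / 5) (by norm_num)
    (by norm_num) (by linarith [w₀_bounds6.1]) (by positivity) ?_ ?_ ?_ hV
  · refine h2.trans ?_
    rw [div_le_iff₀ (by positivity)]
    nlinarith [Ival_02_le, Real.pi_pos]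
  · intro q hq q' hq' hne
    have := hsep q (Finset.mem_of_mem_filter q hq) q' (Finset.mem_of_mem_filter q' hq') hne
    linarith
  · intro q hq
    have := (Finset.mem_filter.1 hq).2
    linarith
  · intro q hq
    have := (Finset.mem_filter.1 hq).2
    linarith

/-! #### The multiplicity inequality `k ≤ 1 + k(k-1)/2` integrated -/

/-- `k ≤ 1 + (k² - k)/2` for natural `k`, in `ℝ≥0∞`. [cite: Yuhjtman2015, Thm. 9 (proof)] -/
theorem natCast_le_one_add_half (k : ℕ) :
    (k : ℝ≥0∞) ≤ 1 + 2⁻¹ * ((k * k - k : ℕ) : ℝ≥0∞) := by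
  have h : 2 * k ≤ 2 + (k * k - k) := by
    rcases k with _ | _ | k
    · simp
    · simp
    · have : (k + 2) * (k + 2) - (k + 2) = (k + 2) * (k + 1) := by
        rw [show (k + 2) * (k + 2) = (k + 2) * (k + 1) + (k + 2) by ring, Nat.add_sub_cancel]
      rw [this]
      nlinarith
  have h2 : (2 : ℝ≥0∞)⁻¹ * 2 = 1 := ENNReal.inv_mul_cancel (by norm_num) (by norm_num)
  calc (k : ℝ≥0∞) = 2⁻¹ * ((2 * k : ℕ) : ℝ≥0∞) := by
        push_cast; rw [← mul_assoc, h2, one_mul]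
    _ ≤ 2⁻¹ * ((2 + (k * k - k) : ℕ) : ℝ≥0∞) := by gcongr
    _ = 1 + 2⁻¹ * ((k * k - k : ℕ) : ℝ≥0∞) := by
        push_cast; rw [mul_add, h2]

/-- **Multiplicity inequality, integrated** (Thm. 9, proof: a point lying in exactly `k` of the
balls `B_y` is counted `k` times on the left and `1 + C(k,2) ≥ k` times on the right):
`∑_{q} ∫_{B_q} F ≤ ∫ F + ½ ∑_{(q,q'), q ≠ q'} ∫_{B_q ∩ B_{q'}} F`.
[cite: Yuhjtman2015, Thm. 9 (proof)] -/
theorem sum_lintegral_ball_le (Q : Finset (EuclideanSpace ℝ (Fin 3))) (c : ℝ)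
    {F : EuclideanSpace ℝ (Fin 3) → ℝ≥0∞} (hF : Measurable F) :
    ∑ q ∈ Q, ∫⁻ y in ball q c, F y ≤
      (∫⁻ y, F y) + 2⁻¹ * ∑ pr ∈ Q.offDiag, ∫⁻ y in ball pr.1 c ∩ ball pr.2 c, F y := by
  have hmeas : ∀ q ∈ Q, Measurable ((ball q c).indicator F) := fun q _ => hF.indicator measurableSet_ball
  have hmeas2 : ∀ pr ∈ Q.offDiag, Measurable ((ball pr.1 c ∩ ball pr.2 c).indicator F) :=
    fun pr _ => hF.indicator (measurableSet_ball.inter measurableSet_ball)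
  simp_rw [← lintegral_indicator measurableSet_ball,
    ← lintegral_indicator (measurableSet_ball.inter measurableSet_ball)]
  rw [← lintegral_finsetSum _ hmeas, ← lintegral_finsetSum _ hmeas2,
    ← lintegral_const_mul _ (Finset.measurable_sum _ hmeas2), ← lintegral_add_left hF]
  refine lintegral_mono fun y => ?_
  -- pointwise: the balls containing `y`
  set T := Q.filter fun q => y ∈ ball q c with hT
  have h1 : ∑ q ∈ Q, (ball q c).indicator F y = (T.card : ℝ≥0∞) * F y := by
    rw [show ∑ q ∈ Q, (ball q c).indicator F y = ∑ q ∈ Q, if y ∈ ball q c then F y else 0 from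
      Finset.sum_congr rfl fun q _ => indicator_apply _ _ _, ← Finset.sum_filter,
      Finset.sum_const, nsmul_eq_mul]
  have h2 : ∑ pr ∈ Q.offDiag, (ball pr.1 c ∩ ball pr.2 c).indicator F y =
      (T.offDiag.card : ℝ≥0∞) * F y := by
    rw [show ∑ pr ∈ Q.offDiag, (ball pr.1 c ∩ ball pr.2 c).indicator F y =
      ∑ pr ∈ Q.offDiag, if y ∈ ball pr.1 c ∩ ball pr.2 c then F y else 0 from
      Finset.sum_congr rfl fun pr _ => indicator_apply _ _ _, ← Finset.sum_filter]
    have : Q.offDiag.filter (fun pr => y ∈ ball pr.1 c ∩ ball pr.2 c) = T.offDiag := by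
      ext pr
      simp only [Finset.mem_filter, Finset.mem_offDiag, mem_inter_iff, hT]
      tauto
    rw [this, Finset.sum_const, nsmul_eq_mul]
  rw [h1, h2, Finset.offDiag_card, ← mul_assoc, ← one_add_mul]
  exact mul_le_mul_of_nonneg_right (natCast_le_one_add_half T.card) zero_le

/-! #### The per-particle estimate -/

/-- The translated majorant `F_p(y) = θ^{0.54}(‖y - p‖)` as an `ℝ≥0∞`-valued function is
measurable. [cite: Yuhjtman2015, Thm. 9 (proof)] -/
theorem measurable_F (p : EuclideanSpace ℝ (Fin 3)) :
    Measurable fun y : EuclideanSpace ℝ (Fin 3) => ENNReal.ofReal (θcut (27 / 50) ‖y - p‖) :=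
  ((measurable_θcut _).comp (measurable_id.sub_const p).norm).ennreal_ofReal

/-- `∫ F_p = 4π I(0.54)`. [cite: Yuhjtman2015, Thm. 9 (proof)] -/
theorem lintegral_F (p : EuclideanSpace ℝ (Fin 3)) :
    ∫⁻ y : EuclideanSpace ℝ (Fin 3), ENNReal.ofReal (θcut (27 / 50) ‖y - p‖) =
      ENNReal.ofReal (4 * Real.pi * (100 / 99 * w₀ ^ 3 - 180 / 121 * w₀ * (27 / 50) ^ 2 + 25 / 33 * (27 / 50) ^ 3)) := by
  rw [lintegral_sub_right_eq_self (fun y : EuclideanSpace ℝ (Fin 3) =>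
    ENNReal.ofReal (θcut (27 / 50) ‖y‖)) p]
  exact lintegral_θcut (by norm_num) (by linarith [w₀_bounds6.1])

/-- **Prop. 8 for the ball about `q` seen from `p`** (`‖q - p‖ ≥ 0.51`):
`|B| g(‖q - p‖) ≤ ∫_{B(q, 0.49)} θ^{0.54}(‖y - p‖) dy` with `g = 1` up to `1.03` and `g = θ`
beyond. [cite: Yuhjtman2015, Prop. 8] -/
theorem ball_bound_prop8 {q p : EuclideanSpace ℝ (Fin 3)} (hqp : 51 / 100 ≤ ‖q - p‖) :
    4 * Real.pi / 3 * (49 / 100) ^ 3 * (if ‖q - p‖ ≤ 103 / 100 then 1 else θ ‖q - p‖) ≤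
      (∫⁻ y in ball q (49 / 100), ENNReal.ofReal (θcut (27 / 50) ‖y - p‖)).toReal := by
  have hfin : ∫⁻ y in ball q (49 / 100), ENNReal.ofReal (θcut (27 / 50) ‖y - p‖) ≠ ⊤ :=
    ne_top_of_le_ne_top ENNReal.ofReal_ne_top
      ((setLIntegral_le_lintegral _ _).trans (lintegral_F p).le)
  rw [← ENNReal.ofReal_le_iff_le_toReal hfin]
  exact lintegral_ball_ge_of_hatbox (by norm_num) (by norm_num) (by linarith [w₀_bounds6.1])
    (by linarith) (ballIntegrand_prop8 hqp)

/-- Pointwise: `h(d) ≤ g(d) + χ_{d < 0.98} (h(d) - 1)` for `d > 0` (`h ≤ 1`, `h ≤ θ`).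
[cite: Yuhjtman2015, Thm. 9 (proof, first display)] -/
theorem hLJ_le_g_add {d : ℝ} (hd : 0 < d) :
    hLJ d ≤ (if d ≤ 103 / 100 then 1 else θ d) + (if d < 98 / 100 then hLJ d - 1 else 0) := by
  have h1 := hLJ_le_one d
  split_ifs with ha hb hb
  · linarith
  · linarith
  · exfalso; linarith
  · simp only [add_zero]; exact hLJ_le_θ hd

/-- **Per-particle estimate** (Thm. 9, proof, for a fixed `x₀ = p`): for a `0.67`-separated `Q`
and `p ∈ Q`,
`e_Q(p) ≤ |B|⁻¹ (4π I(0.54) + ½ ∑_{(q,q') ⊂ Q∖p, q≠q'} ∫_{B_q ∩ B_{q'}} F_p)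
        + ∑_{q ≠ p, ‖q-p‖ < 0.98} (h(‖q - p‖) - 1)`. [cite: Yuhjtman2015, Thm. 9 (proof)] -/
theorem eY_le (Q : Finset (EuclideanSpace ℝ (Fin 3)))
    (hsep : ∀ q ∈ Q, ∀ q' ∈ Q, q ≠ q' → 67 / 100 ≤ dist q q') {p : EuclideanSpace ℝ (Fin 3)}
    (hp : p ∈ Q) :
    (∑ z ∈ Q.erase p, hLJ ‖z - p‖) ≤
      (4 * Real.pi * (100 / 99 * w₀ ^ 3 - 180 / 121 * w₀ * (27 / 50) ^ 2 + 25 / 33 * (27 / 50) ^ 3) +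
        2⁻¹ * ∑ pr ∈ (Q.erase p).offDiag,
        (∫⁻ y in ball pr.1 (49 / 100) ∩ ball pr.2 (49 / 100),
          ENNReal.ofReal (θcut (27 / 50) ‖y - p‖)).toReal) / (4 * Real.pi / 3 * (49 / 100) ^ 3) +
      ∑ q ∈ (Q.erase p).filter (fun q => ‖q - p‖ < 98 / 100), (hLJ ‖q - p‖ - 1) := by
  set F : EuclideanSpace ℝ (Fin 3) → ℝ≥0∞ := fun y => ENNReal.ofReal (θcut (27 / 50) ‖y - p‖)
    with hFdef
  have hF : Measurable F := measurable_F p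
  have hFint : ∫⁻ y, F y =
      ENNReal.ofReal (4 * Real.pi * (100 / 99 * w₀ ^ 3 - 180 / 121 * w₀ * (27 / 50) ^ 2 + 25 / 33 * (27 / 50) ^ 3)) := lintegral_F p
  have hfin : ∀ A : Set (EuclideanSpace ℝ (Fin 3)), ∫⁻ y in A, F y ≠ ⊤ := fun A =>
    ne_top_of_le_ne_top ENNReal.ofReal_ne_top ((setLIntegral_le_lintegral _ _).trans hFint.le)
  set B : ℝ := 4 * Real.pi / 3 * (49 / 100) ^ 3 with hB
  have hB0 : 0 < B := by positivity
  -- step 1: pointwise `h ≤ g + correction`, summed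
  have hdist : ∀ q ∈ Q.erase p, 67 / 100 ≤ ‖q - p‖ := fun q hq => by
    rw [← dist_eq_norm]; exact hsep q (Finset.mem_of_mem_erase hq) p hp (Finset.ne_of_mem_erase hq)
  have step1 : (∑ z ∈ Q.erase p, hLJ ‖z - p‖) ≤
      ∑ q ∈ Q.erase p, (if ‖q - p‖ ≤ 103 / 100 then 1 else θ ‖q - p‖) +
      ∑ q ∈ Q.erase p, (if ‖q - p‖ < 98 / 100 then hLJ ‖q - p‖ - 1 else 0) := by
    rw [← Finset.sum_add_distrib]
    exact Finset.sum_le_sum fun q hq => hLJ_le_g_add (by linarith [hdist q hq])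
  have step1' : ∑ q ∈ Q.erase p, (if ‖q - p‖ < 98 / 100 then hLJ ‖q - p‖ - 1 else 0) =
      ∑ q ∈ (Q.erase p).filter (fun q => ‖q - p‖ < 98 / 100), (hLJ ‖q - p‖ - 1) := by
    rw [Finset.sum_filter]
  -- step 2: each `g` term is at most `|B|⁻¹ ∫_{B_q} F`
  have step2 : ∑ q ∈ Q.erase p, (if ‖q - p‖ ≤ 103 / 100 then 1 else θ ‖q - p‖) ≤
      (∑ q ∈ Q.erase p, ∫⁻ y in ball q (49 / 100), F y).toReal / B := by
    rw [le_div_iff₀ hB0, ENNReal.toReal_sum fun q _ => hfin _, Finset.sum_mul]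
    refine Finset.sum_le_sum fun q hq => ?_
    have := ball_bound_prop8 (q := q) (p := p) (by linarith [hdist q hq])
    rw [hB]
    linarith
  -- step 3: multiplicity
  have hI0 : 0 ≤ (100 / 99 * w₀ ^ 3 - 180 / 121 * w₀ * (27 / 50) ^ 2 + 25 / 33 * (27 / 50) ^ 3) :=
    Ival_nonneg (by norm_num) (by linarith [w₀_bounds6.1])
  have step3 : (∑ q ∈ Q.erase p, ∫⁻ y in ball q (49 / 100), F y).toReal ≤
      4 * Real.pi * (100 / 99 * w₀ ^ 3 - 180 / 121 * w₀ * (27 / 50) ^ 2 + 25 / 33 * (27 / 50) ^ 3) +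
        2⁻¹ * ∑ pr ∈ (Q.erase p).offDiag,
        (∫⁻ y in ball pr.1 (49 / 100) ∩ ball pr.2 (49 / 100), F y).toReal := by
    have h := sum_lintegral_ball_le (Q.erase p) (49 / 100) hF
    rw [hFint] at h
    have hS : ∑ pr ∈ (Q.erase p).offDiag,
        ∫⁻ y in ball pr.1 (49 / 100) ∩ ball pr.2 (49 / 100), F y ≠ ⊤ :=
      ENNReal.sum_ne_top.2 fun pr _ => hfin _
    have hne : ENNReal.ofReal (4 * Real.pi * (100 / 99 * w₀ ^ 3 - 180 / 121 * w₀ * (27 / 50) ^ 2 + 25 / 33 * (27 / 50) ^ 3)) +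
        2⁻¹ * ∑ pr ∈ (Q.erase p).offDiag,
        ∫⁻ y in ball pr.1 (49 / 100) ∩ ball pr.2 (49 / 100), F y ≠ ⊤ :=
      ENNReal.add_ne_top.2 ⟨ENNReal.ofReal_ne_top, ENNReal.mul_ne_top (by norm_num) hS⟩
    have h' := ENNReal.toReal_mono hne h
    rwa [ENNReal.toReal_add ENNReal.ofReal_ne_top (ENNReal.mul_ne_top (by norm_num) hS),
      ENNReal.toReal_mul, ENNReal.toReal_ofReal (mul_nonneg (by positivity) hI0),
      ENNReal.toReal_inv, ENNReal.toReal_ofNat,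
      ENNReal.toReal_sum (s := (Q.erase p).offDiag) (fun pr _ => hfin _)] at h'
  have step23 := step2.trans (div_le_div_of_nonneg_right step3 hB0.le)
  rw [step1'] at step1
  linarith

/-! #### The pair (intersection) estimate -/

/-- **Intersections are paid for by the close pair** (Thm. 9, proof): for `q ≠ q'` in a
`0.67`-separated `Q` with `‖q - q'‖ = d < 0.98`,
`∑_{p ∈ Q} ∫_{B_q ∩ B_{q'}} F_p ≤ 120 · vol(B_q ∩ B_{q'}) = 120 (π/12)(0.98 - d)²(d + 1.96)`.
[cite: Yuhjtman2015, Thm. 9 (proof)] -/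
theorem sum_lintegral_lens_le (Q : Finset (EuclideanSpace ℝ (Fin 3)))
    (hsep : ∀ q ∈ Q, ∀ q' ∈ Q, q ≠ q' → 67 / 100 ≤ dist q q') {q q' : EuclideanSpace ℝ (Fin 3)}
    (hq : q ∈ Q) (hq' : q' ∈ Q) (hne : q ≠ q') (hd : ‖q - q'‖ < 98 / 100) :
    ∑ p ∈ Q, ∫⁻ y in ball q (49 / 100) ∩ ball q' (49 / 100),
        ENNReal.ofReal (θcut (27 / 50) ‖y - p‖) ≤
      ENNReal.ofReal (120 * (Real.pi / 12 * (2 * (49 / 100) - ‖q - q'‖) ^ 2 *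
        (‖q - q'‖ + 4 * (49 / 100)))) := by
  have hdq : 67 / 100 ≤ ‖q - q'‖ := by rw [← dist_eq_norm]; exact hsep q hq q' hq' hne
  rw [← lintegral_finsetSum _ fun p _ => measurable_F p]
  have hpt : ∀ y, ∑ p ∈ Q, ENNReal.ofReal (θcut (27 / 50) ‖y - p‖) ≤ ENNReal.ofReal 120 := by
    intro y
    rw [← ENNReal.ofReal_sum_of_nonneg fun p _ => θcut_nonneg (by norm_num) _]
    exact ENNReal.ofReal_le_ofReal (sum_θcut_le_K Q hsep y)
  calc ∫⁻ y in ball q (49 / 100) ∩ ball q' (49 / 100), ∑ p ∈ Q, ENNReal.ofReal (θcut (27 / 50) ‖y - p‖)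
      ≤ ∫⁻ _ in ball q (49 / 100) ∩ ball q' (49 / 100), ENNReal.ofReal 120 := lintegral_mono fun y => hpt y
    _ = ENNReal.ofReal 120 * volume (ball q (49 / 100) ∩ ball q' (49 / 100)) := setLIntegral_const _ _
    _ = ENNReal.ofReal 120 * ENNReal.ofReal (Real.pi / 12 * (2 * (49 / 100) - ‖q - q'‖) ^ 2 *
        (‖q - q'‖ + 4 * (49 / 100))) := by
        congr 1
        have hpre : ball q (49 / 100) ∩ ball q' (49 / 100) =
            (fun y => y - q') ⁻¹' (ball (q - q') (49 / 100) ∩ ball 0 (49 / 100)) := by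
          ext y; simp [mem_ball, dist_eq_norm]
        rw [hpre, (measurePreserving_sub_right (volume : Measure (EuclideanSpace ℝ (Fin 3))) q').measure_preimage
          (measurableSet_ball.inter measurableSet_ball).nullMeasurableSet]
        exact Literature.MeasureTheory.Lebesgue.volume_ball_inter_ball_three (by norm_num)
          (by linarith) (by linarith)
    _ = _ := by rw [← ENNReal.ofReal_mul (by norm_num)]

/-! #### The total estimate for well-separated configurations -/

/-- **Theorem 9 for `0.67`-separated configurations**: `U_Q ≤ 2 · 14.316 · |Q|`.
(Sum the per-particle estimates, exchange the order of summation in the intersection terms,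
and cancel each close pair's intersections against `2(h(d) - 1)` by the Appendix inequality;
what remains is `|Q| · 3 I(0.54)/0.49³ = |Q| · 12 I(0.54)/0.98³ < 28.632 |Q|`.)
[cite: Yuhjtman2015, Thm. 9] -/
theorem UY_le_of_separated (Q : Finset (EuclideanSpace ℝ (Fin 3)))
    (hsep : ∀ q ∈ Q, ∀ q' ∈ Q, q ≠ q' → 67 / 100 ≤ dist q q') :
    (∑ p' ∈ Q, ∑ z ∈ Q.erase p', hLJ ‖z - p'‖) ≤ 28632 / 1000 * Q.card := by
  set B : ℝ := 4 * Real.pi / 3 * (49 / 100) ^ 3 with hB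
  have hB0 : 0 < B := by positivity
  set M : ℝ := 4 * Real.pi * (100 / 99 * w₀ ^ 3 - 180 / 121 * w₀ * (27 / 50) ^ 2 + 25 / 33 * (27 / 50) ^ 3) with hM
  -- the lens integrals, as real numbers
  set L : EuclideanSpace ℝ (Fin 3) → (EuclideanSpace ℝ (Fin 3) × EuclideanSpace ℝ (Fin 3)) → ℝ :=
    fun p pr => (∫⁻ y in ball pr.1 (49 / 100) ∩ ball pr.2 (49 / 100),
      ENNReal.ofReal (θcut (27 / 50) ‖y - p‖)).toReal with hL
  have hL0 : ∀ p pr, 0 ≤ L p pr := fun p pr => ENNReal.toReal_nonneg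
  set P : (EuclideanSpace ℝ (Fin 3) × EuclideanSpace ℝ (Fin 3)) → Prop :=
    fun pr => ‖pr.1 - pr.2‖ < 98 / 100 with hP
  -- pairs at distance `≥ 0.98` have empty lenses
  have hLfar : ∀ p pr, ¬ P pr → L p pr = 0 := by
    intro p pr hpr
    rw [hP] at hpr
    simp only [not_lt] at hpr
    have hdisj : ball pr.1 (49 / 100) ∩ ball pr.2 (49 / 100) = (∅ : Set (EuclideanSpace ℝ (Fin 3))) :=
      Set.disjoint_iff_inter_eq_empty.1 (ball_disjoint_ball (by rw [dist_eq_norm]; linarith))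
    simp only [hL, hdisj, Measure.restrict_empty, lintegral_zero_measure, ENNReal.toReal_zero]
  -- step 1: sum the per-particle estimates
  have step1 : (∑ p' ∈ Q, ∑ z ∈ Q.erase p', hLJ ‖z - p'‖) ≤
      ∑ p ∈ Q, ((M + 2⁻¹ * ∑ pr ∈ (Q.erase p).offDiag, L p pr) / B +
      ∑ q ∈ (Q.erase p).filter (fun q => ‖q - p‖ < 98 / 100), (hLJ ‖q - p‖ - 1)) :=
    Finset.sum_le_sum fun p hp => eY_le Q hsep hp
  -- step 2: regroup
  have step2 : ∑ p ∈ Q, ((M + 2⁻¹ * ∑ pr ∈ (Q.erase p).offDiag, L p pr) / B +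
      ∑ q ∈ (Q.erase p).filter (fun q => ‖q - p‖ < 98 / 100), (hLJ ‖q - p‖ - 1)) =
      Q.card * (M / B) + ((2⁻¹ / B) * ∑ p ∈ Q, ∑ pr ∈ (Q.erase p).offDiag.filter P, L p pr +
        ∑ p ∈ Q, ∑ q ∈ (Q.erase p).filter (fun q => ‖q - p‖ < 98 / 100), (hLJ ‖q - p‖ - 1)) := by
    have hin : ∀ p ∈ Q, ∑ pr ∈ (Q.erase p).offDiag, L p pr = ∑ pr ∈ (Q.erase p).offDiag.filter P, L p pr := by
      intro p _
      rw [Finset.sum_filter]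
      refine Finset.sum_congr rfl fun pr _ => ?_
      split_ifs with h
      · rfl
      · exact hLfar p pr h
    have hin' : ∑ p ∈ Q, (M + 2⁻¹ * ∑ pr ∈ (Q.erase p).offDiag, L p pr) / B =
        ∑ p ∈ Q, (M / B + (2⁻¹ / B) * ∑ pr ∈ (Q.erase p).offDiag.filter P, L p pr) :=
      Finset.sum_congr rfl fun p hp => by rw [hin p hp]; ring
    rw [Finset.sum_add_distrib, hin', Finset.sum_add_distrib, Finset.sum_const, nsmul_eq_mul,
      ← Finset.mul_sum]
    ring
  -- step 3: exchange the order of summation in the intersection terms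
  have step3 : ∑ p ∈ Q, ∑ pr ∈ (Q.erase p).offDiag.filter P, L p pr =
      ∑ pr ∈ Q.offDiag.filter P, ∑ p ∈ (Q.erase pr.1).erase pr.2, L p pr := by
    refine Finset.sum_comm' fun p pr => ?_
    simp only [Finset.mem_filter, Finset.mem_offDiag, Finset.mem_erase]
    tauto
  -- step 4: the correction terms as a sum over ordered pairs
  have hmem : ∀ pr : EuclideanSpace ℝ (Fin 3) × EuclideanSpace ℝ (Fin 3),
      pr ∈ Q.offDiag.filter P ↔
        pr.1 ∈ Q ∧ pr.2 ∈ (Q.erase pr.1).filter fun q => ‖q - pr.1‖ < 98 / 100 := by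
    intro pr
    simp only [Finset.mem_filter, Finset.mem_offDiag, Finset.mem_erase, hP]
    constructor
    · rintro ⟨⟨h1, h2, h3⟩, h4⟩; exact ⟨h1, ⟨h3.symm, h2⟩, by rwa [norm_sub_rev]⟩
    · rintro ⟨h1, ⟨h3, h2⟩, h4⟩; exact ⟨⟨h1, h2, fun h => h3 h.symm⟩, by rwa [norm_sub_rev]⟩
  have step4 : ∑ p ∈ Q, ∑ q ∈ (Q.erase p).filter (fun q => ‖q - p‖ < 98 / 100), (hLJ ‖q - p‖ - 1) =
      ∑ pr ∈ Q.offDiag.filter P, (hLJ ‖pr.1 - pr.2‖ - 1) := by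
    have h := Finset.sum_finset_product' (Q.offDiag.filter P) Q
      (fun p => (Q.erase p).filter fun q => ‖q - p‖ < 98 / 100) hmem
      (f := fun a b => hLJ ‖b - a‖ - 1)
    rw [← h]
    exact Finset.sum_congr rfl fun pr _ => by rw [norm_sub_rev]
  -- step 5: each ordered close pair contributes `≤ 0`
  have step5 : ∀ pr ∈ Q.offDiag.filter P,
      (2⁻¹ / B) * ∑ p ∈ (Q.erase pr.1).erase pr.2, L p pr + (hLJ ‖pr.1 - pr.2‖ - 1) ≤ 0 := by
    intro pr hpr
    simp only [Finset.mem_filter, Finset.mem_offDiag, hP] at hpr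
    obtain ⟨⟨h1, h2, h3⟩, h4⟩ := hpr
    set d := ‖pr.1 - pr.2‖ with hd
    have hdlo : 67 / 100 ≤ d := by rw [hd, ← dist_eq_norm]; exact hsep _ h1 _ h2 h3
    -- the inner sum is at most `120 · vol(lens)`
    have hsum : ∑ p ∈ (Q.erase pr.1).erase pr.2, L p pr ≤
        120 * (Real.pi / 12 * (2 * (49 / 100) - d) ^ 2 * (d + 4 * (49 / 100))) := by
      have hsub : (Q.erase pr.1).erase pr.2 ⊆ Q :=
        (Finset.erase_subset _ _).trans (Finset.erase_subset _ _)
      have hle := sum_lintegral_lens_le Q hsep h1 h2 h3 h4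
      have hfin : ∀ p ∈ Q, ∫⁻ y in ball pr.1 (49 / 100) ∩ ball pr.2 (49 / 100),
          ENNReal.ofReal (θcut (27 / 50) ‖y - p‖) ≠ ⊤ := fun p _ =>
        ne_top_of_le_ne_top ENNReal.ofReal_ne_top
          ((setLIntegral_le_lintegral _ _).trans (lintegral_F p).le)
      calc ∑ p ∈ (Q.erase pr.1).erase pr.2, L p pr ≤ ∑ p ∈ Q, L p pr :=
            Finset.sum_le_sum_of_subset_of_nonneg hsub fun p _ _ => hL0 p pr
        _ = (∑ p ∈ Q, ∫⁻ y in ball pr.1 (49 / 100) ∩ ball pr.2 (49 / 100),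
              ENNReal.ofReal (θcut (27 / 50) ‖y - p‖)).toReal := by
            rw [hL, ENNReal.toReal_sum hfin]
        _ ≤ (ENNReal.ofReal (120 * (Real.pi / 12 * (2 * (49 / 100) - d) ^ 2 *
              (d + 4 * (49 / 100))))).toReal := ENNReal.toReal_mono ENNReal.ofReal_ne_top hle
        _ = 120 * (Real.pi / 12 * (2 * (49 / 100) - d) ^ 2 * (d + 4 * (49 / 100))) := by
            refine ENNReal.toReal_ofReal ?_
            have : 0 ≤ d + 4 * (49 / 100) := by linarith
            positivity
    have happ := appendix_ineq hdlo h4.le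
    have hvol : (2⁻¹ / B) * (120 * (Real.pi / 12 * (2 * (49 / 100) - d) ^ 2 * (d + 4 * (49 / 100)))) =
        2⁻¹ * (120 * ((98 / 100 - d) ^ 2 * (d + 196 / 100)) / (16 * (49 / 100) ^ 3)) := by
      rw [hB]
      field_simp
      ring
    have hmono : (2⁻¹ / B) * ∑ p ∈ (Q.erase pr.1).erase pr.2, L p pr ≤
        (2⁻¹ / B) * (120 * (Real.pi / 12 * (2 * (49 / 100) - d) ^ 2 * (d + 4 * (49 / 100)))) :=
      mul_le_mul_of_nonneg_left hsum (by positivity)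
    rw [hvol] at hmono
    linarith
  -- step 6: the main term
  have hmain : M / B ≤ 28632 / 1000 := by
    rw [hM, hB, div_le_iff₀ hB0]
    nlinarith [Ival_054_le, Real.pi_pos]
  -- assembly
  have hpairs : (2⁻¹ / B) * ∑ p ∈ Q, ∑ pr ∈ (Q.erase p).offDiag.filter P, L p pr +
      ∑ p ∈ Q, ∑ q ∈ (Q.erase p).filter (fun q => ‖q - p‖ < 98 / 100), (hLJ ‖q - p‖ - 1) ≤ 0 := by
    rw [step3, step4, Finset.mul_sum, ← Finset.sum_add_distrib]
    exact Finset.sum_nonpos step5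
  calc (∑ p' ∈ Q, ∑ z ∈ Q.erase p', hLJ ‖z - p'‖) ≤ _ := step1
    _ = _ := step2
    _ ≤ Q.card * (M / B) + 0 := by linarith
    _ ≤ 28632 / 1000 * Q.card := by
        rw [add_zero, mul_comm]
        exact mul_le_mul_of_nonneg_right hmain (Nat.cast_nonneg _)

/-! #### The closest pair and the induction -/

/-- **A too-close pair has a member of negative minus-energy** (Prop. 6 / Cor. 7 method with
Prop. 5 I): if `a = ‖q - p‖ < 0.67` is the minimal distance of `Q`, then `e_Q(p) < 0`: the far
points (`‖z - p‖ ≥ 0.89`) contribute at most `24 I(0.54)/a³` by the packing bound with balls of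
radius `a/2`, the near ones contribute `< 0`, and `h(a) + 24 I(0.54)/a³ < 0`.
[cite: Yuhjtman2015, Prop. 6 (proof), Cor. 7] -/
theorem eY_neg_of_close (Q : Finset (EuclideanSpace ℝ (Fin 3))) {p q : EuclideanSpace ℝ (Fin 3)}
    (hq : q ∈ Q) (hpq : p ≠ q)
    (hmin : ∀ z ∈ Q, ∀ z' ∈ Q, z ≠ z' → ‖q - p‖ ≤ dist z z') (ha : ‖q - p‖ < 67 / 100) :
    (∑ z ∈ Q.erase p, hLJ ‖z - p‖) < 0 := by
  set a := ‖q - p‖ with ha_def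
  have ha0 : 0 < a := by rw [ha_def]; exact norm_sub_pos_iff.2 hpq.symm
  set R := (Q.erase p).erase q with hR
  set S := R.filter fun z => 89 / 100 ≤ ‖z - p‖ with hS
  have hq' : q ∈ Q.erase p := Finset.mem_erase.2 ⟨hpq.symm, hq⟩
  -- split off `q`, drop the near points, majorise `h` by `θ` on the far ones
  have h1 : (∑ z ∈ Q.erase p, hLJ ‖z - p‖) = hLJ a + ∑ z ∈ R, hLJ ‖z - p‖ := by
    rw [← Finset.add_sum_erase _ _ hq']
  have h2 : ∑ z ∈ R, hLJ ‖z - p‖ ≤ ∑ z ∈ S, θ ‖z - p‖ := by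
    rw [← Finset.sum_filter_add_sum_filter_not R (fun z => 89 / 100 ≤ ‖z - p‖)]
    have hneg : ∑ z ∈ R.filter (fun z => ¬ 89 / 100 ≤ ‖z - p‖), hLJ ‖z - p‖ ≤ 0 := by
      refine Finset.sum_nonpos fun z hz => ?_
      obtain ⟨-, hz⟩ := Finset.mem_filter.1 hz
      exact hLJ_nonpos (norm_nonneg _) (by linarith)
    have hfar : ∑ z ∈ S, hLJ ‖z - p‖ ≤ ∑ z ∈ S, θ ‖z - p‖ :=
      Finset.sum_le_sum fun z hz => hLJ_le_θ (by linarith [(Finset.mem_filter.1 hz).2])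
    rw [hS]
    linarith
  -- the packing bound for the far points
  have hV : ∫⁻ y : EuclideanSpace ℝ (Fin 3), ENNReal.ofReal (θcut (27 / 50) ‖y‖) ≤
      ENNReal.ofReal (4 * Real.pi * (100 / 99 * w₀ ^ 3 - 180 / 121 * w₀ * (27 / 50) ^ 2 + 25 / 33 * (27 / 50) ^ 3)) :=
    (lintegral_θcut (by norm_num) (by linarith [w₀_bounds6.1])).le
  have hI0 : 0 ≤ (100 / 99 * w₀ ^ 3 - 180 / 121 * w₀ * (27 / 50) ^ 2 + 25 / 33 * (27 / 50) ^ 3) :=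
    Ival_nonneg (by norm_num) (by linarith [w₀_bounds6.1])
  have h3 := sum_θ_le_of_lintegral_le S p (c := a / 2) (s := 27 / 50) (by positivity)
    (by norm_num) (by linarith [w₀_bounds6.1]) (by positivity) ?_ ?_ ?_ hV
  · have h4 : 3 * (4 * Real.pi * (100 / 99 * w₀ ^ 3 - 180 / 121 * w₀ * (27 / 50) ^ 2 + 25 / 33 * (27 / 50) ^ 3)) /
        (4 * Real.pi * (a / 2) ^ 3) =
        24 * (100 / 99 * w₀ ^ 3 - 180 / 121 * w₀ * (27 / 50) ^ 2 + 25 / 33 * (27 / 50) ^ 3) / a ^ 3 := by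
      field_simp
      ring
    rw [h4] at h3
    have h5 := closePair_neg ha0 ha.le
    linarith
  · intro z hz z' hz' hne
    have hzQ : z ∈ Q := Finset.mem_of_mem_erase (Finset.mem_of_mem_erase (Finset.mem_of_mem_filter z hz))
    have hz'Q : z' ∈ Q := Finset.mem_of_mem_erase (Finset.mem_of_mem_erase (Finset.mem_of_mem_filter z' hz'))
    have := hmin z hzQ z' hz'Q hne
    linarith
  · intro z hz
    have := (Finset.mem_filter.1 hz).2
    linarith
  · intro z hz
    have := (Finset.mem_filter.1 hz).2
    linarith

/-- **Theorem 9 (finite-set form): `U_Q ≤ 28.632 |Q|` for every finite `Q ⊂ ℝ³`.** Strong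
induction on `Q`: if some point has `e_Q(p) ≤ 0`, remove it (`U_Q = U_{Q∖p} + 2e_Q(p)`);
otherwise the minimal distance is `≥ 0.67` (`eY_neg_of_close`) and `UY_le_of_separated` applies.
(This replaces Yuhjtman's appeal to the existence of optimal configurations, Prop. 6, and to
Cor. 7.) [cite: Yuhjtman2015, Thm. 9] -/
theorem UY_le (Q : Finset (EuclideanSpace ℝ (Fin 3))) :
    (∑ p' ∈ Q, ∑ z ∈ Q.erase p', hLJ ‖z - p'‖) ≤ 28632 / 1000 * Q.card := by
  induction Q using Finset.strongInduction with
  | H Q ih =>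
    by_cases hA : ∃ p ∈ Q, (∑ z ∈ Q.erase p, hLJ ‖z - p‖) ≤ 0
    · obtain ⟨p, hp, hep⟩ := hA
      have h1 := UY_eq_UY_erase_add hp
      have h2 := ih (Q.erase p) (Finset.erase_ssubset hp)
      have h3 : ((Q.erase p).card : ℝ) ≤ Q.card := by
        exact_mod_cast Finset.card_le_card (Finset.erase_subset p Q)
      nlinarith
    · push Not at hA
      by_cases hcard : Q.card ≤ 1
      · rw [UY_eq_zero_of_card_le_one hcard]; positivity
      · -- a closest pair
        have hne : Q.offDiag.Nonempty := by
          obtain ⟨a, ha, b, hb, hab⟩ := Finset.one_lt_card.1 (not_le.1 hcard)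
          exact ⟨(a, b), Finset.mem_offDiag.2 ⟨ha, hb, hab⟩⟩
        obtain ⟨pr, hpr, hmin⟩ := Finset.exists_min_image Q.offDiag (fun pr => dist pr.1 pr.2) hne
        obtain ⟨h1, h2, h3⟩ := Finset.mem_offDiag.1 hpr
        have hmin' : ∀ z ∈ Q, ∀ z' ∈ Q, z ≠ z' → ‖pr.2 - pr.1‖ ≤ dist z z' := by
          intro z hz z' hz' hzz'
          have := hmin (z, z') (Finset.mem_offDiag.2 ⟨hz, hz', hzz'⟩)
          rwa [dist_eq_norm, norm_sub_rev] at this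
        by_cases hsep : 67 / 100 ≤ ‖pr.2 - pr.1‖
        · exact UY_le_of_separated Q fun z hz z' hz' hzz' => hsep.trans (hmin' z hz z' hz' hzz')
        · exact absurd (eY_neg_of_close Q h2 h3 hmin' (not_le.1 hsep)) (not_lt.2 (hA pr.1 h1).le)

end Assembly

/-! ### The discharge -/

/-- **Yuhjtman 2015, Theorem 9** — discharge of the named fact
`Yuhjtman2015_stabilityConstant`: for every configuration of `N` distinct points of `ℝ³`,
`∑_{i<j} V_LJ(|xᵢ - xⱼ|) ≥ -(14.316/12) N` (`V_LJ = r⁻¹²/12 - r⁻⁶/6`), i.e. Yuhjtman's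
`(1/|Q|) ∑ Φ(‖x - y‖) > -14.316` for `Φ = 12 V_LJ`. [cite: Yuhjtman2015, Thm. 9] -/
theorem stabilityConstant_holds : Yuhjtman2015_stabilityConstant := by
  classical
  intro N x hx
  set Q : Finset (EuclideanSpace ℝ (Fin 3)) := Finset.univ.image x with hQ
  have hcard : Q.card = N := by
    rw [hQ, Finset.card_image_of_injective _ hx, Finset.card_univ, Fintype.card_fin]
  -- site energies as sums over the image finset
  have hsite : ∀ i, siteEnergy lennardJones x i = -(1 / 12) * (∑ z ∈ Q.erase (x i), hLJ ‖z - (x i)‖) := by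
    intro i
    unfold siteEnergy
    rw [hQ, ← Finset.image_erase hx, Finset.sum_image fun a _ b _ h => hx h, Finset.mul_sum]
    refine Finset.sum_congr rfl fun k _ => ?_
    rw [dist_eq_norm, ← norm_sub_rev, hLJ_eq_lennardJones]
    ring
  have hsum : ∑ i, siteEnergy lennardJones x i = -(1 / 12) * (∑ p' ∈ Q, ∑ z ∈ Q.erase p', hLJ ‖z - p'‖) := by
    rw [hQ, Finset.sum_image fun a _ b _ h => hx h, ← hQ, Finset.mul_sum]
    exact Finset.sum_congr rfl fun i _ => hsite i
  have h2 := two_mul_interactionEnergy lennardJones x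
  have hU := UY_le Q
  rw [hcard] at hU
  rw [hsum] at h2
  linarith

end Stability

end Yuhjtman2015

/-- **Discharge of `Yuhjtman2015_stabilityConstant`** (Yuhjtman 2015, Thm. 9: the Lennard-Jones
stability constant in `ℝ³` is at most `14.316`). [cite: Yuhjtman2015, Thm. 9] -/
theorem Yuhjtman2015_stabilityConstant_holds : Yuhjtman2015_stabilityConstant :=
  Yuhjtman2015.Stability.stabilityConstant_holds

end Literature.MathematicalPhysics.StatisticalMechanics

end
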